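import Mathlib
import Literature.Analysis.ODE.GlobalExistence
import Literature.Barriers.NavierStokesRegularity.DyadicCascadeRegularity
import HarnessLib

/-!
# Cheskidov's dyadic model: global strong solutions for `α ≥ 1/2`
  (proof of the named fact `Dyadic.Cheskidov2008_thm44`)

Barrier catalogue `Literature/Barriers/NavierStokesRegularity/`, sibling **proof file** of
`DyadicCascadeRegularity`: it proves `theorem Cheskidov2008_thm44_holds : Cheskidov2008_thm44`,
i.e. Theorem 4.4 of Cheskidov 2008 — for `λ > 1`, `ν > 0`, `α ≥ 1/2`, a square-summable force and
a datum `u⁰ ∈ V = H^α` the dyadic model (3.1),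
`uₙ' = -νλ^{2αn}uₙ + λⁿu_{n-1}² - λ^{n+1}uₙu_{n+1} + gₙ` (`u₀ = 0`), has a solution on `[0, ∞)`
(Def. 3.1: `ℓ²`-valued, `C¹` components) whose enstrophy norm `‖u(t)‖²_α = ∑ λ^{2αn}uₙ(t)²` is
bounded on every `[0, T]`. Theorem-only module (no definitions).

## The printed proof (Cheskidov 2008, §4, pp. 7–8 of the arXiv text) and its transcription

* **Galerkin approximations** (proof of Thm. 4.1): `u^k = (u^k_1, …, u^k_k, 0, …)` solves the
  truncated system (the `k`-th equation without the term `u_k u_{k+1}`); "the energy estimate …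
  obviously holds for `u^k(t)`. Hence, from the theory of ordinary differential equations we know
  that there exists a unique solution `u^k(t)` … on `[0,∞)`". Here: `exists_galerkin_solution`,
  an ODE in `Fin N → ℝ` fed into the continuation principle
  `Literature.Analysis.ODE.exists_solution_of_apriori_bound` (`Literature/Analysis/ODE/GlobalExistence`,
  Teschl 2012, Cor. 2.16) with the energy bound `energy_le` (Grönwall form of
  `½ d/dt |u|² ≤ -ν‖u‖² + (g,u)`, the flux `∑ (λⁿu_{n-1}²uₙ - λ^{n+1}uₙ²u_{n+1})` telescoping to
  zero, `sum_flux_eq_zero`).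
* **Enstrophy estimate for `α ≥ 1/2`** (§4, "Enstrophy estimates": `(B(u,u),Au) ≤ c_b|Au|‖u‖²`,
  whence the Riccati-type inequality `½ d/dt‖u‖² ≤ -ν/3 |Au|² + (3c_b²/4ν)‖u‖⁴ + (3/4ν)|g|²`).
  Here: `sum_wt_mul_cheskidovRHS_le`, `d/dt ‖u‖² ≤ a‖u‖⁴ + b` with the (non-sharp) constants
  `a = 3(λ^{4α}+1)/(2ν)`, `b = 3|g|²/(2ν)`, obtained term-wise from `λⁿ ≤ λ^{2αn}` (`α ≥ 1/2`,
  `pow_le_wt`) and Young's inequality, the dissipation `|Au|²` being absorbed exactly as printed.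
* **No blow-up** (the paragraph before Thm. 4.4: a blow-up `‖u(t)‖ → ∞` at `t*` would force
  `‖u(t)‖² ≥ c/(t* - t)`, "not locally integrable, which is in contradiction with the energy
  inequality"). Here, constructively and uniformly in the truncation (`enstrophy_le`): with
  `Q(t) = (|u(0)|² - |u(t)|² + (|g|² + R²)t)/(2ν) ≥ ∫₀ᵗ‖u‖²` (energy identity) the function
  `‖u‖² e^{-aQ}` has derivative `≤ b`, so `‖u(t)‖² ≤ (‖u(0)‖² + bT) e^{aK(T)}` on `[0, T]`.
* **Passage to the limit** (proof of Thm. 4.1: equicontinuity, Ascoli–Arzelà, "by a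
  diagonalization process", then "taking the limit as `k_j → ∞`, we obtain
  `uₙ(t) = uₙ(0) + ∫₀ᵗ (…) dτ`. Since `uₙ(t)` is continuous, it follows that `uₙ ∈ C¹([0,∞))` and
  satisfies (3.1)"). Here: `exists_subseq_tendsto` (Tychonoff at rational times,
  `IsCompact.tendsto_subseq`, plus the equi-Lipschitz modulus), the integral identity for the
  approximations (FTC), dominated convergence, and the FTC for the limit; the uniform enstrophy
  bound passes to the limit on partial sums, which gives `u(t) ∈ H^α ⊆ ℓ²` with the printed bound
  on every `[0, T]` (`Cheskidov2008_thm44_holds`).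

## Audit (barrier audit 2026-08-16, second pass: the `α ≥ 1/2` piece of the entry)

What this proof file certifies and what, as a barrier, it blocks — page references to the held
arXiv texts.

* **Transcription.** Def. 3.1 (p. 6 of the arXiv text): a weak solution on `[T, ∞)` is an
  `H`-valued `u(t)` with `uₙ ∈ C¹([T,∞))` satisfying (3.1) for all `n`; "we say that a solution
  `u(t)` is strong (or regular) on some interval `[T₁,T₂]`, if `‖u(t)‖` is bounded on `[T₁,T₂]`.
  A solution is strong on `[T₁,∞)`, if it is strong on every interval `[T₁,T₂]`"; standing
  hypotheses (p. 6): "`λ > 1`, the viscosity `ν > 0`, the dissipation degree `α > 0` … For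
  simplicity, assume that `g` is independent of time, `g ∈ H`, and `gₙ ≥ 0` for all `n`";
  Thm. 4.4 (p. 8): "If `α ≥ 1/2`, then for any `u⁰ ∈ V` there exists a strong solution `u(t)` to
  (3.1) on `[0,∞)` with `u(0) = u⁰`." The fact `Cheskidov2008_thm44` renders this symbol by
  symbol (`IsCheskidovSolution` = Def. 3.1 from `T = 0`; strong = `‖u(t)‖²_α` bounded on every
  `[0, T]`; no sign condition on the datum — the energy method needs none); the theorem below is
  checked with axioms `propext`, `Classical.choice`, `Quot.sound`. [cite: Cheskidov2008, §3 Def. 3.1 and (3.1); §4 Thm. 4.4]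
* **The sign of the force is not used.** The standing hypothesis `gₙ ≥ 0` enters the paper only
  through positivity (Thm. 4.2) and the blow-up argument of §5; the energy and enstrophy estimates
  of §4 hold for every `g ∈ H`. Accordingly `exists_strong_solution_of_half_le` below states the
  result for all time-independent square-summable forces and `Cheskidov2008_thm44_holds` is its
  specialisation: as a barrier the entry covers signed forcing too (Filonov–Khodunov state
  Cheskidov's existence theorem for `β ≤ 2` with time-dependent `fₙ ≥ 0`, `∑∫fₙ² < ∞`).
  [cite: Cheskidov2008, §4 "Energy estimates", "Enstrophy estimates"] [cite: FilonovKhodunov2021, Thm. 0.9]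
* **What the theorem does not say, and where the complement is in print.** Thm. 4.4 is an
  EXISTENCE statement; "no solution launched from `u⁰ ∈ V` loses regularity" needs in addition a
  weak–strong uniqueness theorem, which is NOT formalised here (the tree's only uniqueness result
  for these models is BMR Prop. 3.2, `IsBMRWeakSolution.unique`: `λ = 2`, `β ≤ 3`, non-negative
  data). In print, in the dictionary `λ_Ch = λ_BMR^β`, `αβ = 1` (so `α ≥ 1/2` is `β ≤ 2`)
  [cite: Filonov2017, Introduction §0.3]: (a) for `α ≥ 1/2` every Leray–Hopf solution satisfies
  the energy equality, and "for every initial datum in `H` there exists a regular solution on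
  `[0,∞)`. Moreover, it can be shown that such a solution is unique in the class of all Leray–Hopf
  solutions" (stated without proof) [cite: Cheskidov2008, §6 Thm. 6.4 and the remark after Cor. 6.5];
  (b) for `β ≤ 2`, every `λ > 1` and EVERY `ℓ²` datum (any signs) the unforced model has a unique
  Leray–Hopf solution [cite: Filonov2017, Thm. 7], and the same holds with a time-dependent force
  `∑ₙ λ^{-2n}∫₀ᵀfₙ² < ∞` [cite: FilonovKhodunov2021, Thm. 0.5], whereas for `β > 2` a force of
  that class produces two Leray–Hopf solutions from the zero datum [cite: FilonovKhodunov2021, Thm. 0.6];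
  (c) a datum with `a_{n_k} ≥ 0` along a subsequence makes every weak solution Leray–Hopf
  [cite: Filonov2017, Lemma 1.2 and the remark after it], and for `β ≤ 2` no non-trivial
  stationary solution is square-summable, so the stationary mechanism behind "a weak solution to
  (0.1) may be non-unique if `β > 2`" is absent [cite: Filonov2017, Thm. 9 a) and §0.4]. Residual
  case not treated in these sources: uniqueness of sign-changing weak solutions (Def. 3.1, no
  energy inequality) from data negative from some index on — a wild-solution (non-uniqueness)
  question, not a blow-up of the strong solution, hence immaterial for Clay-type blow-up theses.
* **Robustness of the regime `α ≥ 1/2` (technique class).** The production bound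
  `sum_wt_mul_cheskidovRHS_le` uses only `|coefficient| ≤ λⁿ ≤ λ^{2αn}` and Young's inequality
  against the dissipation, so the argument is insensitive to the signs and the precise form of a
  finite-range quadratic coupling with coefficients `O(λⁿ)` once the energy inequality holds. In
  print: with additive Gaussian noise "the same method also works … and it is straightforward to
  prove path-wise uniqueness in the case `β ≤ 2`" [cite: Romito2014NoisyDyadic, §1 p. 3]; at
  critical dissipation weakened by a logarithm — `Xₙ' = φ_{n-1}k_{n-1}X²_{n-1} - φₙkₙXₙX_{n+1} -
  kₙXₙ/gₙ`, `kₙ = 2^{βn}`, ANY bounded coefficients `φ` ("the role of the coefficients `φ` is to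
  break the structure of the non-linearity"), `gₙ` non-decreasing with `∑ gₙ⁻¹ = ∞` — smooth data
  have global solutions bounded in every `H^s`, also for uniformly bounded time- and
  state-dependent couplings and for Tao's vector-valued dyadic model
  [cite: BarbatoMorandinRomito2014Dyadic, §1.1, Thm. 5 and §3.3.1]; the survey records Thm. 4.4
  as Thm. 12 and the uniqueness threshold `d = 1` (`θ = 2`, i.e. `α = 1/2`) as sharp
  [cite: CheskidovDaiFriedlander2023, §3.2.1 Thm. 12, §3.2.3 Thms. 18–20]. Hence every dyadic
  blow-up construction for the negation of `NavierStokesRegularity` must be power-supercritical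
  (`α < 1/2`; Tao's averaged blow-up sits at `α = 2/5`), as the parent entry's `because:` line
  says; verdict of this pass: CONFIRMED, no narrowing.

## References

* A. Cheskidov, *Blow-up in finite time for the dyadic model of the Navier–Stokes equations*,
  Trans. Amer. Math. Soc. 360 (2008), 5101–5120, §3 Def. 3.1, §4 Thm. 4.1 (proof), "Enstrophy
  estimates", Thm. 4.4. [`Cheskidov2008`]
* G. Teschl, *Ordinary Differential Equations and Dynamical Systems*, GSM 140 (AMS 2012),
  Cor. 2.16 (via `Literature/Analysis/ODE/GlobalExistence`). [`Teschl2012`]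
* N. Filonov, *Uniqueness of the Leray–Hopf solution for a dyadic model*, Trans. Amer. Math.
  Soc. 369 (2017), 8663–8684, §0.3 Thm. 7, Lemma 1.2, Thm. 9 (arXiv:1506.07480). [`Filonov2017`]
* N. Filonov, P. Khodunov, *Nonuniqueness of Leray–Hopf solutions for a dyadic model*,
  St. Petersburg Math. J. 32 (2021), 371–387, Thms. 0.5, 0.6, 0.9 (arXiv:2004.01074). [`FilonovKhodunov2021`]
* M. Romito, *Uniqueness and blow-up for a stochastic viscous dyadic model*, Probab. Theory
  Related Fields 158 (2014), 895–924, §1 (arXiv:1111.0536). [`Romito2014NoisyDyadic`]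
* D. Barbato, F. Morandin, M. Romito, *Global regularity for a logarithmically supercritical
  hyperdissipative dyadic equation*, Dyn. PDE 11 (2014), 39–52, §1.1, Thm. 5, §3.3.1
  (arXiv:1403.2852). [`BarbatoMorandinRomito2014Dyadic`]
* A. Cheskidov, M. Dai, S. Friedlander, *Dyadic models for fluid equations: a survey*, J. Math.
  Fluid Mech. 25 (2023), Paper 62, §3.2 (arXiv:2209.10203). [`CheskidovDaiFriedlander2023`]
-/

noncomputable section

open Set Filter Topology Metric MeasureTheory

open scoped NNReal ENNReal

namespace Literature.Barriers.NavierStokesRegularity.Dyadic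

/-! ## Elementary inequalities and weights -/

/-- Young's inequality with a parameter: `2xy ≤ εx² + y²/ε` for `ε > 0`. [folklore] -/
theorem two_mul_le_eps {ε : ℝ} (hε : 0 < ε) (x y : ℝ) : 2 * x * y ≤ ε * x ^ 2 + y ^ 2 / ε := by
  have h : 0 ≤ (ε * x - y) ^ 2 / ε := by positivity
  have h2 : (ε * x - y) ^ 2 / ε = ε * x ^ 2 - 2 * x * y + y ^ 2 / ε := by
    field_simp
    ring
  linarith [h, h2]

variable {lam α : ℝ}

/-- The weights `λ^{2αm}` of the scale `H^α` are positive (`λ > 1`). [cite: Cheskidov2008, §3] -/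
theorem wt_pos (hlam : 1 < lam) (α : ℝ) (m : ℕ) : 0 < lam ^ (2 * α * m) :=
  Real.rpow_pos_of_pos (by linarith) _

/-- `λ^{2αm} ≥ 1` for `λ > 1`, `α ≥ 0`, so that `|u| ≤ ‖u‖_α` (the Poincaré-type inequality
`|u|² ≤ λ^{-2α}‖u‖²` of §3). [cite: Cheskidov2008, §3] -/
theorem one_le_wt (hlam : 1 < lam) (hα : 0 ≤ α) (m : ℕ) : 1 ≤ lam ^ (2 * α * m) :=
  Real.one_le_rpow hlam.le (by positivity)

/-- `λ^{2α(m+1)} = λ^{2α} λ^{2αm}`. [folklore] -/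
theorem wt_succ (hlam : 1 < lam) (α : ℝ) (m : ℕ) :
    lam ^ (2 * α * (m + 1 : ℕ)) = lam ^ (2 * α) * lam ^ (2 * α * m) := by
  rw [← Real.rpow_add (by linarith)]
  push_cast
  ring_nf

/-- For `α ≥ 1/2` and `λ > 1` the coupling coefficients are dominated by the weights,
`λ^m ≤ λ^{2αm}` — the elementary inequality behind `(B(u,u),Au) ≤ c_b |Au| ‖u‖²` in the case
`α ≥ 1/2` of the enstrophy estimates. [cite: Cheskidov2008, §4 Enstrophy estimates] -/
theorem pow_le_wt (hlam : 1 < lam) (hα : 1 / 2 ≤ α) (m : ℕ) : lam ^ m ≤ lam ^ (2 * α * m) := by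
  rw [← Real.rpow_natCast]
  refine Real.rpow_le_rpow_of_exponent_le hlam.le ?_
  have hm : (0 : ℝ) ≤ m := Nat.cast_nonneg m
  nlinarith

/-! ## The energy flux telescopes -/

variable {ν : ℝ} {g : ℕ → ℝ}

/-- The right-hand side of (3.1) at mode `m + 1`, with the index arithmetic resolved:
`-νλ^{2α(m+1)}u_{m+1} + λ^{m+1}u_m² - λ^{m+2}u_{m+1}u_{m+2} + g_{m+1}`. [cite: Cheskidov2008, §3 (3.1)] -/
theorem cheskidovRHS_succ (lam ν α : ℝ) (g : ℕ → ℝ) (u : ℕ → ℝ) (m : ℕ) :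
    cheskidovRHS lam ν α g u (m + 1) =
      -ν * lam ^ (2 * α * (m + 1 : ℕ)) * u (m + 1) + lam ^ (m + 1) * u m ^ 2 -
        lam ^ (m + 2) * u (m + 1) * u (m + 2) + g (m + 1) := by
  simp only [cheskidovRHS, Nat.add_sub_cancel]

/-- **The nonlinear energy flux telescopes**: for a state with `u₀ = 0` and `u_{N+1} = 0`,
`∑_{n=1}^{N} uₙ (λⁿu_{n-1}² - λ^{n+1}uₙu_{n+1}) = 0` — the orthogonality property `(B(u,u),u) = 0`
of §3, for the Galerkin truncation at level `N`. [cite: Cheskidov2008, §3] -/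
theorem sum_flux_eq_zero (lam : ℝ) {N : ℕ} {u : ℕ → ℝ} (h0 : u 0 = 0) (hN : u (N + 1) = 0) :
    ∑ m ∈ Finset.range N,
      u (m + 1) * (lam ^ (m + 1) * u m ^ 2 - lam ^ (m + 2) * u (m + 1) * u (m + 2)) = 0 := by
  have := Finset.sum_range_sub' (fun m => lam ^ (m + 1) * u m ^ 2 * u (m + 1)) N
  simp only [h0, hN] at this
  rw [show (fun m => u (m + 1) * (lam ^ (m + 1) * u m ^ 2 - lam ^ (m + 2) * u (m + 1) * u (m + 2)))
      = fun m => lam ^ (m + 1) * u m ^ 2 * u (m + 1) -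
          lam ^ (m + 1 + 1) * u (m + 1) ^ 2 * u (m + 1 + 1) from
      funext fun m => by ring]
  rw [this]
  simp

/-- **Energy identity for the Galerkin truncation**: for states with `u₀ = u_{N+1} = 0`,
`2∑_{n ≤ N} uₙ · RHSₙ(u) = -2ν ∑_{n ≤ N} λ^{2αn}uₙ² + 2∑_{n ≤ N} gₙuₙ` (the computation of §4,
"Energy estimates", and of the proof of Thm. 4.2, at the Galerkin level where it is exact). [cite: Cheskidov2008, §4 Thm. 4.2 (proof)] -/
theorem sum_mul_cheskidovRHS_eq (lam ν α : ℝ) (g : ℕ → ℝ) {N : ℕ} {u : ℕ → ℝ} (h0 : u 0 = 0)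
    (hN : u (N + 1) = 0) :
    2 * ∑ m ∈ Finset.range N, u (m + 1) * cheskidovRHS lam ν α g u (m + 1) =
      -2 * ν * ∑ m ∈ Finset.range N, lam ^ (2 * α * (m + 1 : ℕ)) * u (m + 1) ^ 2 +
        2 * ∑ m ∈ Finset.range N, g (m + 1) * u (m + 1) := by
  have hflux := sum_flux_eq_zero lam h0 hN
  have : ∀ m, u (m + 1) * cheskidovRHS lam ν α g u (m + 1) =
      -ν * (lam ^ (2 * α * (m + 1 : ℕ)) * u (m + 1) ^ 2) +
        u (m + 1) * (lam ^ (m + 1) * u m ^ 2 - lam ^ (m + 2) * u (m + 1) * u (m + 2)) +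
        g (m + 1) * u (m + 1) := by
    intro m
    rw [cheskidovRHS_succ]
    ring
  simp only [this, Finset.sum_add_distrib, hflux, ← Finset.mul_sum]
  ring

/-- **Energy inequality in Grönwall form**: `2∑ uₙ RHSₙ(u) ≤ -2ν‖u‖²_α + ∑ gₙ² + ∑ uₙ²`
(Young's inequality on the force term of the energy identity). [cite: Cheskidov2008, §4 Energy estimates] -/
theorem sum_mul_cheskidovRHS_le (lam ν α : ℝ) (g : ℕ → ℝ) {N : ℕ} {u : ℕ → ℝ} (h0 : u 0 = 0)
    (hN : u (N + 1) = 0) :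
    2 * ∑ m ∈ Finset.range N, u (m + 1) * cheskidovRHS lam ν α g u (m + 1) ≤
      -2 * ν * ∑ m ∈ Finset.range N, lam ^ (2 * α * (m + 1 : ℕ)) * u (m + 1) ^ 2 +
        ∑ m ∈ Finset.range N, g (m + 1) ^ 2 + ∑ m ∈ Finset.range N, u (m + 1) ^ 2 := by
  rw [sum_mul_cheskidovRHS_eq lam ν α g h0 hN]
  have : 2 * ∑ m ∈ Finset.range N, g (m + 1) * u (m + 1) ≤
      ∑ m ∈ Finset.range N, g (m + 1) ^ 2 + ∑ m ∈ Finset.range N, u (m + 1) ^ 2 := by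
    rw [Finset.mul_sum, ← Finset.sum_add_distrib]
    exact Finset.sum_le_sum fun m _ => by nlinarith [sq_nonneg (g (m + 1) - u (m + 1))]
  linarith

/-! ## The enstrophy inequality for states -/

/-- **Enstrophy production bound for `α ≥ 1/2`** (the case `α ≥ 1/2` of §4, "Enstrophy
estimates": `(B(u,u),Au) ≤ c_b|Au|‖u‖²`, whence `½ d/dt ‖u‖² ≤ -ν/3|Au|² + (3c_b²/4ν)‖u‖⁴ +
(3/4ν)|g|²`). For a state with `u₀ = u_{N+1} = 0`, `λ > 1`, `ν > 0`, `α ≥ 1/2`: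
`2∑_{n ≤ N} λ^{2αn}uₙ RHSₙ(u) ≤ a (∑_{n ≤ N} λ^{2αn}uₙ²)² + (3/2ν) ∑_{n ≤ N} gₙ²` with the non-sharp
constant `a = 3(λ^{4α} + 1)/(2ν)`: each cubic term is bounded using `λⁿ ≤ λ^{2αn}` (`pow_le_wt`)
and Young's inequality against one third of the dissipation `2ν|Au|²`, which is absorbed
completely. [cite: Cheskidov2008, §4 Enstrophy estimates] -/
theorem sum_wt_mul_cheskidovRHS_le (hlam : 1 < lam) (hν : 0 < ν) (hα : 1 / 2 ≤ α) (g : ℕ → ℝ)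
    {N : ℕ} {u : ℕ → ℝ} (h0 : u 0 = 0) (hN : u (N + 1) = 0) :
    2 * ∑ m ∈ Finset.range N,
        lam ^ (2 * α * (m + 1 : ℕ)) * u (m + 1) * cheskidovRHS lam ν α g u (m + 1) ≤
      3 * (lam ^ (4 * α) + 1) / (2 * ν) *
          (∑ m ∈ Finset.range N, lam ^ (2 * α * (m + 1 : ℕ)) * u (m + 1) ^ 2) ^ 2 +
        3 / (2 * ν) * ∑ m ∈ Finset.range N, g (m + 1) ^ 2 := by
  -- notation
  set w : ℕ → ℝ := fun m => lam ^ (2 * α * m) with hw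
  have hwpos : ∀ m, 0 < w m := fun m => wt_pos hlam α m
  have hw1 : ∀ m, w (m + 1) = lam ^ (2 * α) * w m := fun m => wt_succ hlam α m
  have hl2a : 1 ≤ lam ^ (2 * α) := Real.one_le_rpow hlam.le (by linarith)
  have hpw : ∀ m, lam ^ m ≤ w m := fun m => pow_le_wt hlam hα m
  set ε : ℝ := 2 * ν / 3 with hε
  have hεpos : 0 < ε := by positivity
  set W : ℝ := ∑ m ∈ Finset.range N, w (m + 1) * u (m + 1) ^ 2 with hW
  set D : ℝ := ∑ m ∈ Finset.range N, (w (m + 1) * u (m + 1)) ^ 2 with hD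
  set G : ℝ := ∑ m ∈ Finset.range N, g (m + 1) ^ 2 with hG
  have hWnn : 0 ≤ W := Finset.sum_nonneg fun m _ => by
    have := hwpos (m + 1); positivity
  -- expand
  have hexp : ∀ m, w (m + 1) * u (m + 1) * cheskidovRHS lam ν α g u (m + 1) =
      -ν * (w (m + 1) * u (m + 1)) ^ 2 +
        lam ^ (m + 1) * w (m + 1) * u m ^ 2 * u (m + 1) -
        lam ^ (m + 2) * w (m + 1) * u (m + 1) ^ 2 * u (m + 2) +
        w (m + 1) * g (m + 1) * u (m + 1) := by
    intro m
    rw [cheskidovRHS_succ]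
    ring
  -- term (i)
  have h1 : ∀ m, 2 * (lam ^ (m + 1) * w (m + 1) * u m ^ 2 * u (m + 1)) ≤
      ε * (w (m + 1) * u (m + 1)) ^ 2 + (lam ^ (4 * α) / ε) * (w m * u m ^ 2) ^ 2 := by
    intro m
    have hkey : lam ^ (m + 1) ≤ lam ^ (2 * α) * w m := by rw [← hw1]; exact hpw (m + 1)
    have hum : 0 ≤ u m ^ 2 := sq_nonneg _
    have hA : 2 * (lam ^ (m + 1) * w (m + 1) * u m ^ 2 * u (m + 1)) ≤
        2 * (w (m + 1) * |u (m + 1)|) * (lam ^ (2 * α) * (w m * u m ^ 2)) := by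
      have h2 : lam ^ (m + 1) * w (m + 1) * u m ^ 2 * u (m + 1) ≤
          lam ^ (m + 1) * w (m + 1) * u m ^ 2 * |u (m + 1)| := by
        have : 0 ≤ lam ^ (m + 1) * w (m + 1) * u m ^ 2 := by
          have := hwpos (m + 1); positivity
        exact mul_le_mul_of_nonneg_left (le_abs_self _) this
      have h3 : lam ^ (m + 1) * w (m + 1) * u m ^ 2 * |u (m + 1)| ≤
          lam ^ (2 * α) * w m * w (m + 1) * u m ^ 2 * |u (m + 1)| := by
        have : 0 ≤ w (m + 1) * u m ^ 2 * |u (m + 1)| := by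
          have := hwpos (m + 1); positivity
        calc lam ^ (m + 1) * w (m + 1) * u m ^ 2 * |u (m + 1)|
            = lam ^ (m + 1) * (w (m + 1) * u m ^ 2 * |u (m + 1)|) := by ring
          _ ≤ lam ^ (2 * α) * w m * (w (m + 1) * u m ^ 2 * |u (m + 1)|) :=
            mul_le_mul_of_nonneg_right hkey this
          _ = _ := by ring
      nlinarith [h2, h3]
    have hB := two_mul_le_eps hεpos (w (m + 1) * |u (m + 1)|) (lam ^ (2 * α) * (w m * u m ^ 2))
    rw [mul_pow, sq_abs, mul_pow] at hB
    calc _ ≤ _ := hA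
      _ ≤ _ := hB
      _ = _ := by
        rw [show (lam ^ (2 * α)) ^ 2 = lam ^ (4 * α) by
          rw [← Real.rpow_natCast, ← Real.rpow_mul (by linarith)]; norm_num; ring_nf]
        ring
  -- term (ii)
  have h2 : ∀ m, 2 * (-(lam ^ (m + 2) * w (m + 1) * u (m + 1) ^ 2 * u (m + 2))) ≤
      ε * (w (m + 2) * u (m + 2)) ^ 2 + (1 / ε) * (w (m + 1) * u (m + 1) ^ 2) ^ 2 := by
    intro m
    have hkey : lam ^ (m + 2) ≤ w (m + 2) := hpw (m + 2)
    have hA : 2 * (-(lam ^ (m + 2) * w (m + 1) * u (m + 1) ^ 2 * u (m + 2))) ≤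
        2 * (w (m + 2) * |u (m + 2)|) * (w (m + 1) * u (m + 1) ^ 2) := by
      have h2 : -(lam ^ (m + 2) * w (m + 1) * u (m + 1) ^ 2 * u (m + 2)) ≤
          lam ^ (m + 2) * w (m + 1) * u (m + 1) ^ 2 * |u (m + 2)| := by
        have : 0 ≤ lam ^ (m + 2) * w (m + 1) * u (m + 1) ^ 2 := by
          have := hwpos (m + 1); positivity
        rw [← mul_neg]
        exact mul_le_mul_of_nonneg_left (neg_le_abs _) this
      have h3 : lam ^ (m + 2) * w (m + 1) * u (m + 1) ^ 2 * |u (m + 2)| ≤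
          w (m + 2) * w (m + 1) * u (m + 1) ^ 2 * |u (m + 2)| := by
        have : 0 ≤ w (m + 1) * u (m + 1) ^ 2 * |u (m + 2)| := by
          have := hwpos (m + 1); positivity
        calc lam ^ (m + 2) * w (m + 1) * u (m + 1) ^ 2 * |u (m + 2)|
            = lam ^ (m + 2) * (w (m + 1) * u (m + 1) ^ 2 * |u (m + 2)|) := by ring
          _ ≤ w (m + 2) * (w (m + 1) * u (m + 1) ^ 2 * |u (m + 2)|) :=
            mul_le_mul_of_nonneg_right hkey this
          _ = _ := by ring
      nlinarith [h2, h3]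
    have hB := two_mul_le_eps hεpos (w (m + 2) * |u (m + 2)|) (w (m + 1) * u (m + 1) ^ 2)
    rw [mul_pow, sq_abs] at hB
    calc _ ≤ _ := hA
      _ ≤ _ := hB
      _ = _ := by ring
  -- term (iii)
  have h3 : ∀ m, 2 * (w (m + 1) * g (m + 1) * u (m + 1)) ≤
      ε * (w (m + 1) * u (m + 1)) ^ 2 + g (m + 1) ^ 2 / ε := by
    intro m
    have hB := two_mul_le_eps hεpos (w (m + 1) * u (m + 1)) (g (m + 1))
    calc 2 * (w (m + 1) * g (m + 1) * u (m + 1))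
        = 2 * (w (m + 1) * u (m + 1)) * g (m + 1) := by ring
      _ ≤ _ := hB
  -- shifted sums
  have hs1 : ∑ m ∈ Finset.range N, (w m * u m ^ 2) ^ 2 ≤ W ^ 2 := by
    have hle : ∑ m ∈ Finset.range N, (w m * u m ^ 2) ^ 2 ≤
        ∑ m ∈ Finset.range N, (w (m + 1) * u (m + 1) ^ 2) ^ 2 := by
      cases N with
      | zero => simp
      | succ N =>
        rw [Finset.sum_range_succ' (fun m => (w m * u m ^ 2) ^ 2), h0]
        simp only [ne_eq, OfNat.ofNat_ne_zero, not_false_eq_true, zero_pow, mul_zero, add_zero]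
        rw [Finset.sum_range_succ]
        have : 0 ≤ (w (N + 1) * u (N + 1) ^ 2) ^ 2 := sq_nonneg _
        linarith
    refine hle.trans ?_
    rw [hW]
    exact Finset.sum_sq_le_sq_sum_of_nonneg fun m _ => by have := hwpos (m + 1); positivity
  have hs2 : ∑ m ∈ Finset.range N, (w (m + 1) * u (m + 1) ^ 2) ^ 2 ≤ W ^ 2 := by
    rw [hW]
    exact Finset.sum_sq_le_sq_sum_of_nonneg fun m _ => by have := hwpos (m + 1); positivity
  have hs3 : ∑ m ∈ Finset.range N, (w (m + 2) * u (m + 2)) ^ 2 ≤ D := by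
    have : ∑ m ∈ Finset.range (N + 1), (w (m + 1) * u (m + 1)) ^ 2 =
        ∑ m ∈ Finset.range N, (w (m + 2) * u (m + 2)) ^ 2 + (w 1 * u 1) ^ 2 := by
      rw [Finset.sum_range_succ']
    have h' : ∑ m ∈ Finset.range (N + 1), (w (m + 1) * u (m + 1)) ^ 2 = D := by
      rw [Finset.sum_range_succ, hN]
      simp [hD]
    nlinarith [sq_nonneg (w 1 * u 1)]
  -- assemble: sum the three term-wise bounds
  have hSi : ∑ m ∈ Finset.range N, 2 * (lam ^ (m + 1) * w (m + 1) * u m ^ 2 * u (m + 1)) ≤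
      ε * D + lam ^ (4 * α) / ε * W ^ 2 := by
    refine (Finset.sum_le_sum fun m _ => h1 m).trans ?_
    rw [Finset.sum_add_distrib, ← Finset.mul_sum, ← Finset.mul_sum]
    have : lam ^ (4 * α) / ε * ∑ m ∈ Finset.range N, (w m * u m ^ 2) ^ 2 ≤
        lam ^ (4 * α) / ε * W ^ 2 :=
      mul_le_mul_of_nonneg_left hs1 (by positivity)
    linarith
  have hSii : ∑ m ∈ Finset.range N, 2 * (-(lam ^ (m + 2) * w (m + 1) * u (m + 1) ^ 2 * u (m + 2))) ≤
      ε * D + 1 / ε * W ^ 2 := by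
    refine (Finset.sum_le_sum fun m _ => h2 m).trans ?_
    rw [Finset.sum_add_distrib, ← Finset.mul_sum, ← Finset.mul_sum]
    have e1 : ε * ∑ m ∈ Finset.range N, (w (m + 2) * u (m + 2)) ^ 2 ≤ ε * D :=
      mul_le_mul_of_nonneg_left hs3 hεpos.le
    have e2 : 1 / ε * ∑ m ∈ Finset.range N, (w (m + 1) * u (m + 1) ^ 2) ^ 2 ≤ 1 / ε * W ^ 2 :=
      mul_le_mul_of_nonneg_left hs2 (by positivity)
    linarith
  have hSiii : ∑ m ∈ Finset.range N, 2 * (w (m + 1) * g (m + 1) * u (m + 1)) ≤ ε * D + G / ε := by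
    refine (Finset.sum_le_sum fun m _ => h3 m).trans ?_
    rw [Finset.sum_add_distrib, ← Finset.mul_sum, ← Finset.sum_div]
  have hsplit : 2 * ∑ m ∈ Finset.range N, w (m + 1) * u (m + 1) * cheskidovRHS lam ν α g u (m + 1) =
      -2 * ν * D + ∑ m ∈ Finset.range N, 2 * (lam ^ (m + 1) * w (m + 1) * u m ^ 2 * u (m + 1)) +
        ∑ m ∈ Finset.range N, 2 * (-(lam ^ (m + 2) * w (m + 1) * u (m + 1) ^ 2 * u (m + 2))) +
        ∑ m ∈ Finset.range N, 2 * (w (m + 1) * g (m + 1) * u (m + 1)) := by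
    simp only [hexp, hD, Finset.mul_sum, ← Finset.sum_add_distrib]
    refine Finset.sum_congr rfl fun m _ => ?_
    ring
  have hεD : -2 * ν * D + ε * D + ε * D + ε * D = 0 := by rw [hε]; ring
  have hcoef : lam ^ (4 * α) / ε * W ^ 2 + 1 / ε * W ^ 2 + G / ε =
      3 * (lam ^ (4 * α) + 1) / (2 * ν) * W ^ 2 + 3 / (2 * ν) * G := by
    rw [hε]
    field_simp
  show 2 * ∑ m ∈ Finset.range N, w (m + 1) * u (m + 1) * cheskidovRHS lam ν α g u (m + 1) ≤
      3 * (lam ^ (4 * α) + 1) / (2 * ν) * W ^ 2 + 3 / (2 * ν) * G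
  rw [hsplit]
  linarith


/-! ## Grönwall on a closed interval from one-sided derivatives -/

/-- Grönwall's bound (Mathlib's `le_gronwallBound_of_liminf_deriv_right_le`) for a real function
with a derivative within `[0, s]` at every point of `[0, s]`: `f' ≤ K f + C` on `[0, s)` gives
`f t ≤ gronwallBound (f 0) K C t`. [folklore] -/
theorem le_gronwallBound_Icc {f f' : ℝ → ℝ} {K C s : ℝ}
    (hf : ∀ t ∈ Icc 0 s, HasDerivWithinAt f (f' t) (Icc 0 s) t)
    (hbound : ∀ t ∈ Ico 0 s, f' t ≤ K * f t + C) :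
    ∀ t ∈ Icc 0 s, f t ≤ gronwallBound (f 0) K C t := by
  intro t ht
  have hcont : ContinuousOn f (Icc 0 s) := fun τ hτ => (hf τ hτ).continuousWithinAt
  have := le_gronwallBound_of_liminf_deriv_right_le (f := f) (f' := f') (δ := f 0) (K := K)
    (ε := C) (a := 0) (b := s) hcont (fun τ hτ r hr => ?_) le_rfl hbound t ht
  · simpa using this
  · have hmem : Icc 0 s ∈ 𝓝[Ici τ] τ :=
      mem_nhdsWithin.2 ⟨Iio s, isOpen_Iio, hτ.2, fun z hz => ⟨hτ.1.trans hz.2, hz.1.le⟩⟩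
    exact ((hf τ (Ico_subset_Icc_self hτ)).mono_of_mem_nhdsWithin hmem).liminf_right_slope_le hr

/-- A derivative bounded by `C` within `[0, s]` gives `f t ≤ f 0 + C t` on `[0, s]`. [folklore] -/
theorem le_add_mul_of_deriv_le_Icc {f f' : ℝ → ℝ} {C s : ℝ}
    (hf : ∀ t ∈ Icc 0 s, HasDerivWithinAt f (f' t) (Icc 0 s) t)
    (hbound : ∀ t ∈ Ico 0 s, f' t ≤ C) :
    ∀ t ∈ Icc 0 s, f t ≤ f 0 + C * t := by
  intro t ht
  have := le_gronwallBound_Icc hf (K := 0) (C := C) (fun τ hτ => by simpa using hbound τ hτ) t ht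
  simpa [gronwallBound_K0] using this

/-- `(f²)' = 2 f f'` within a set. [folklore] -/
theorem hasDerivWithinAt_sq {f : ℝ → ℝ} {f' : ℝ} {S : Set ℝ} {t : ℝ}
    (h : HasDerivWithinAt f f' S t) :
    HasDerivWithinAt (fun x => f x ^ 2) (2 * f t * f') S t := by
  have := h.fun_pow 2
  simpa using this

/-! ## A priori bounds for Galerkin solutions on `[0, s]` -/

section Apriori

variable {lam ν α : ℝ} {g : ℕ → ℝ} {N : ℕ} {s : ℝ} {u : ℕ → ℝ → ℝ}

/-- Derivative of the truncated energy `∑_{n ≤ N} uₙ(t)²` along a Galerkin solution on `[0, s]`. [folklore] -/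
theorem hasDerivWithinAt_energy
    (hd : ∀ m < N, ∀ t ∈ Icc 0 s, HasDerivWithinAt (u (m + 1))
      (cheskidovRHS lam ν α g (fun k => u k t) (m + 1)) (Icc 0 s) t) {t : ℝ} (ht : t ∈ Icc 0 s) :
    HasDerivWithinAt (fun τ => ∑ m ∈ Finset.range N, u (m + 1) τ ^ 2)
      (2 * ∑ m ∈ Finset.range N, u (m + 1) t * cheskidovRHS lam ν α g (fun k => u k t) (m + 1))
      (Icc 0 s) t := by
  rw [Finset.mul_sum]
  have := HasDerivWithinAt.fun_sum (u := Finset.range N)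
    (A := fun m τ => u (m + 1) τ ^ 2)
    fun m hm => hasDerivWithinAt_sq (hd m (Finset.mem_range.1 hm) t ht)
  simpa [mul_assoc] using this

/-- Derivative of the truncated enstrophy `∑_{n ≤ N} λ^{2αn}uₙ(t)²` along a Galerkin solution on
`[0, s]`. [folklore] -/
theorem hasDerivWithinAt_enstrophy
    (hd : ∀ m < N, ∀ t ∈ Icc 0 s, HasDerivWithinAt (u (m + 1))
      (cheskidovRHS lam ν α g (fun k => u k t) (m + 1)) (Icc 0 s) t) {t : ℝ} (ht : t ∈ Icc 0 s) :
    HasDerivWithinAt (fun τ => ∑ m ∈ Finset.range N, lam ^ (2 * α * (m + 1 : ℕ)) * u (m + 1) τ ^ 2)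
      (2 * ∑ m ∈ Finset.range N, lam ^ (2 * α * (m + 1 : ℕ)) * u (m + 1) t *
        cheskidovRHS lam ν α g (fun k => u k t) (m + 1))
      (Icc 0 s) t := by
  rw [Finset.mul_sum]
  refine (HasDerivWithinAt.fun_sum (u := Finset.range N)
    (A := fun m τ => lam ^ (2 * α * (m + 1 : ℕ)) * u (m + 1) τ ^ 2)
    fun m hm => (hasDerivWithinAt_sq (hd m (Finset.mem_range.1 hm) t ht)).const_mul
      (lam ^ (2 * α * (m + 1 : ℕ)))).congr_deriv ?_
  exact Finset.sum_congr rfl fun m _ => by ring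

/-- **Energy a priori bound for the Galerkin truncation** (the uniform bound "there exists `M`,
such that `u^k_n(t) ≤ M` for all `n, k, t ≥ 0`" of the proof of Thm. 4.1, here on finite horizons):
if `u₀ ≡ 0`, `u_{N+1} ≡ 0` and the modes `1, …, N` solve (3.1) within `[0, s]`, `ν ≥ 0`, `λ > 1`,
then `∑_{n ≤ N} uₙ(t)² ≤ (∑_{n ≤ N} uₙ(0)² + G) eˢ` on `[0, s]` for any `G ≥ ∑_{n ≤ N} gₙ²`
(Grönwall with `K = 1` on `sum_mul_cheskidovRHS_le`). [cite: Cheskidov2008, §4 Thm. 4.1 (proof)] -/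
theorem energy_le (h0 : ∀ t, u 0 t = 0) (hN : ∀ t, u (N + 1) t = 0)
    (hd : ∀ m < N, ∀ t ∈ Icc 0 s, HasDerivWithinAt (u (m + 1))
      (cheskidovRHS lam ν α g (fun k => u k t) (m + 1)) (Icc 0 s) t)
    (hν : 0 ≤ ν) (hlam : 1 < lam) {G : ℝ} (hG : ∑ m ∈ Finset.range N, g (m + 1) ^ 2 ≤ G) :
    ∀ t ∈ Icc 0 s, ∑ m ∈ Finset.range N, u (m + 1) t ^ 2 ≤
      (∑ m ∈ Finset.range N, u (m + 1) 0 ^ 2 + G) * Real.exp s := by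
  intro t ht
  have hG0 : 0 ≤ G := le_trans (Finset.sum_nonneg fun m _ => sq_nonneg _) hG
  have hE0 : 0 ≤ ∑ m ∈ Finset.range N, u (m + 1) 0 ^ 2 := Finset.sum_nonneg fun m _ => sq_nonneg _
  have hbound : ∀ τ ∈ Ico 0 s,
      2 * ∑ m ∈ Finset.range N, u (m + 1) τ * cheskidovRHS lam ν α g (fun k => u k τ) (m + 1) ≤
        1 * (∑ m ∈ Finset.range N, u (m + 1) τ ^ 2) + G := by
    intro τ hτ
    have h := sum_mul_cheskidovRHS_le lam ν α g (N := N) (u := fun k => u k τ) (h0 τ) (hN τ)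
    have hW : 0 ≤ ∑ m ∈ Finset.range N, lam ^ (2 * α * (m + 1 : ℕ)) * u (m + 1) τ ^ 2 :=
      Finset.sum_nonneg fun m _ => by have := wt_pos hlam α (m + 1); positivity
    nlinarith
  have := le_gronwallBound_Icc (fun τ hτ => hasDerivWithinAt_energy hd hτ) hbound t ht
  rw [gronwallBound_of_K_ne_0 one_ne_zero] at this
  simp only [one_mul, div_one] at this
  refine this.trans ?_
  have hexp : Real.exp t ≤ Real.exp s := Real.exp_le_exp.2 ht.2
  have h1 : 1 ≤ Real.exp t := Real.one_le_exp ht.1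
  nlinarith

/-- **Enstrophy a priori bound for the Galerkin truncation, `α ≥ 1/2`** (the no-blow-up argument
preceding Thm. 4.4: the Riccati-type inequality for `‖u‖²` together with the local integrability of
`‖u‖²` coming from the energy inequality excludes `‖u(t)‖ → ∞`; here in a constructive form that is
uniform in the truncation level). If the modes `1, …, N` solve (3.1) within `[0, s]`
(`u₀ ≡ u_{N+1} ≡ 0`), `∑ gₙ² ≤ G` and the energy obeys `∑_{n ≤ N} uₙ(t)² ≤ R₂` on `[0, s]`, then
with `a = 3(λ^{4α}+1)/(2ν)`, `b = 3G/(2ν)`, `K = (R₂ + (G + R₂)s)/(2ν)`: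
`∑_{n ≤ N} λ^{2αn}uₙ(t)² ≤ (∑_{n ≤ N} λ^{2αn}uₙ(0)² + b s) e^{aK}` on `[0, s]`. Proof: with
`W = ∑ λ^{2αn}uₙ²`, `E = ∑ uₙ²` and `Q(t) = (E(0) - E(t) + (G + R₂)t)/(2ν)` one has `Q' ≥ W`
(energy identity), `0 ≤ Q ≤ K`, and `W' ≤ aW² + b` (`sum_wt_mul_cheskidovRHS_le`), so
`(W e^{-aQ})' ≤ b`. [cite: Cheskidov2008, §4 Thm. 4.4 (proof)] -/
theorem enstrophy_le (h0 : ∀ t, u 0 t = 0) (hN : ∀ t, u (N + 1) t = 0)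
    (hd : ∀ m < N, ∀ t ∈ Icc 0 s, HasDerivWithinAt (u (m + 1))
      (cheskidovRHS lam ν α g (fun k => u k t) (m + 1)) (Icc 0 s) t)
    (hlam : 1 < lam) (hν : 0 < ν) (hα : 1 / 2 ≤ α) (hs : 0 ≤ s)
    {G : ℝ} (hG : ∑ m ∈ Finset.range N, g (m + 1) ^ 2 ≤ G)
    {R2 : ℝ} (hR2 : ∀ t ∈ Icc 0 s, ∑ m ∈ Finset.range N, u (m + 1) t ^ 2 ≤ R2) :
    ∀ t ∈ Icc 0 s, ∑ m ∈ Finset.range N, lam ^ (2 * α * (m + 1 : ℕ)) * u (m + 1) t ^ 2 ≤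
      (∑ m ∈ Finset.range N, lam ^ (2 * α * (m + 1 : ℕ)) * u (m + 1) 0 ^ 2 + 3 / (2 * ν) * G * s) *
        Real.exp (3 * (lam ^ (4 * α) + 1) / (2 * ν) * ((R2 + (G + R2) * s) / (2 * ν))) := by
  -- notation
  set E : ℝ → ℝ := fun τ => ∑ m ∈ Finset.range N, u (m + 1) τ ^ 2 with hE
  set e' : ℝ → ℝ := fun τ =>
    2 * ∑ m ∈ Finset.range N, u (m + 1) τ * cheskidovRHS lam ν α g (fun k => u k τ) (m + 1) with he'
  set W : ℝ → ℝ := fun τ =>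
    ∑ m ∈ Finset.range N, lam ^ (2 * α * (m + 1 : ℕ)) * u (m + 1) τ ^ 2 with hW
  set w' : ℝ → ℝ := fun τ => 2 * ∑ m ∈ Finset.range N, lam ^ (2 * α * (m + 1 : ℕ)) * u (m + 1) τ *
    cheskidovRHS lam ν α g (fun k => u k τ) (m + 1) with hw'
  set a : ℝ := 3 * (lam ^ (4 * α) + 1) / (2 * ν) with ha
  set b : ℝ := 3 / (2 * ν) * G with hb
  set K : ℝ := (R2 + (G + R2) * s) / (2 * ν) with hK
  have hG0 : 0 ≤ G := le_trans (Finset.sum_nonneg fun m _ => sq_nonneg _) hG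
  have hEnn : ∀ τ, 0 ≤ E τ := fun τ => Finset.sum_nonneg fun m _ => sq_nonneg _
  have hWnn : ∀ τ, 0 ≤ W τ := fun τ =>
    Finset.sum_nonneg fun m _ => by have := wt_pos hlam α (m + 1); positivity
  have hR2nn : 0 ≤ R2 := (hEnn 0).trans (hR2 0 ⟨le_rfl, hs⟩)
  have hl4 : 0 < lam ^ (4 * α) := Real.rpow_pos_of_pos (by linarith) _
  have ha0 : 0 ≤ a := by positivity
  have hb0 : 0 ≤ b := by positivity
  have hdE : ∀ τ ∈ Icc 0 s, HasDerivWithinAt E (e' τ) (Icc 0 s) τ := fun τ hτ =>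
    hasDerivWithinAt_energy hd hτ
  have hdW : ∀ τ ∈ Icc 0 s, HasDerivWithinAt W (w' τ) (Icc 0 s) τ := fun τ hτ =>
    hasDerivWithinAt_enstrophy hd hτ
  -- (1) the energy flux bound
  have he'le : ∀ τ ∈ Icc 0 s, e' τ ≤ -2 * ν * W τ + (G + R2) := by
    intro τ hτ
    have h := sum_mul_cheskidovRHS_le lam ν α g (N := N) (u := fun k => u k τ) (h0 τ) (hN τ)
    have := hR2 τ hτ
    simp only [he', hW]
    linarith
  -- (2) integrated energy inequality
  have hEle : ∀ τ ∈ Icc 0 s, E τ ≤ E 0 + (G + R2) * τ :=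
    le_add_mul_of_deriv_le_Icc hdE fun τ hτ => by
      have := he'le τ (Ico_subset_Icc_self hτ)
      have := hWnn τ
      nlinarith
  -- (3) the integrating factor `Q`
  set Q : ℝ → ℝ := fun τ => (E 0 - E τ + (G + R2) * τ) / (2 * ν) with hQ
  have hdQ : ∀ τ ∈ Icc 0 s, HasDerivWithinAt Q ((-e' τ + (G + R2)) / (2 * ν)) (Icc 0 s) τ := by
    intro τ hτ
    have h1 : HasDerivWithinAt (fun x => E 0 - E x + (G + R2) * x) (0 - e' τ + (G + R2) * 1)
        (Icc 0 s) τ :=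
      ((hasDerivWithinAt_const τ _ (E 0)).sub (hdE τ hτ)).add
        ((hasDerivWithinAt_id τ _).const_mul (G + R2))
    exact (h1.div_const (2 * ν)).congr_deriv (by ring)
  have hQ'ge : ∀ τ ∈ Icc 0 s, W τ ≤ (-e' τ + (G + R2)) / (2 * ν) := by
    intro τ hτ
    rw [le_div_iff₀ (by positivity)]
    have := he'le τ hτ
    linarith
  have hQnn : ∀ τ ∈ Icc 0 s, 0 ≤ Q τ := by
    intro τ hτ
    simp only [hQ]
    exact div_nonneg (by have := hEle τ hτ; linarith) (by positivity)
  have hQle : ∀ τ ∈ Icc 0 s, Q τ ≤ K := by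
    intro τ hτ
    simp only [hQ, hK]
    refine div_le_div_of_nonneg_right ?_ (by positivity)
    have := hEnn τ
    have := hR2 0 ⟨le_rfl, hs⟩
    have : (G + R2) * τ ≤ (G + R2) * s := mul_le_mul_of_nonneg_left hτ.2 (by positivity)
    linarith
  have hQ0 : Q 0 = 0 := by simp [hQ]
  -- (4) the enstrophy production bound
  have hw'le : ∀ τ ∈ Icc 0 s, w' τ ≤ a * W τ ^ 2 + b := by
    intro τ _
    have h := sum_wt_mul_cheskidovRHS_le hlam hν hα g (N := N) (u := fun k => u k τ) (h0 τ) (hN τ)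
    simp only [hw', hW, ha, hb]
    refine h.trans ?_
    have : 3 / (2 * ν) * ∑ m ∈ Finset.range N, g (m + 1) ^ 2 ≤ 3 / (2 * ν) * G :=
      mul_le_mul_of_nonneg_left hG (by positivity)
    linarith
  -- (5) `Z = W exp(-aQ)` has derivative `≤ b`
  set Z : ℝ → ℝ := fun τ => W τ * Real.exp (-a * Q τ) with hZ
  have hdZ : ∀ τ ∈ Icc 0 s, HasDerivWithinAt Z
      (w' τ * Real.exp (-a * Q τ) +
        W τ * (Real.exp (-a * Q τ) * (-a * ((-e' τ + (G + R2)) / (2 * ν)))))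
      (Icc 0 s) τ := by
    intro τ hτ
    exact (hdW τ hτ).mul (((hdQ τ hτ).const_mul (-a)).exp)
  have hZ'le : ∀ τ ∈ Ico 0 s,
      w' τ * Real.exp (-a * Q τ) +
          W τ * (Real.exp (-a * Q τ) * (-a * ((-e' τ + (G + R2)) / (2 * ν)))) ≤ b := by
    intro τ hτ'
    have hτ : τ ∈ Icc 0 s := Ico_subset_Icc_self hτ'
    have hexp_pos : 0 < Real.exp (-a * Q τ) := Real.exp_pos _
    have hexp_le : Real.exp (-a * Q τ) ≤ 1 := by
      rw [Real.exp_le_one_iff]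
      have := hQnn τ hτ
      nlinarith
    have h1 := hw'le τ hτ
    have h2 := hQ'ge τ hτ
    have h3 := hWnn τ
    -- `w' - a W Q' ≤ a W² + b - a W · W = b`
    have hkey : w' τ + W τ * (-a * ((-e' τ + (G + R2)) / (2 * ν))) ≤ b := by
      have : a * W τ * W τ ≤ a * W τ * ((-e' τ + (G + R2)) / (2 * ν)) :=
        mul_le_mul_of_nonneg_left h2 (by positivity)
      nlinarith
    calc w' τ * Real.exp (-a * Q τ) +
          W τ * (Real.exp (-a * Q τ) * (-a * ((-e' τ + (G + R2)) / (2 * ν))))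
        = Real.exp (-a * Q τ) * (w' τ + W τ * (-a * ((-e' τ + (G + R2)) / (2 * ν)))) := by ring
      _ ≤ Real.exp (-a * Q τ) * b := mul_le_mul_of_nonneg_left hkey hexp_pos.le
      _ ≤ 1 * b := mul_le_mul_of_nonneg_right hexp_le hb0
      _ = b := one_mul b
  -- (6) integrate
  have hZle : ∀ τ ∈ Icc 0 s, Z τ ≤ Z 0 + b * τ := le_add_mul_of_deriv_le_Icc hdZ hZ'le
  have hZ0 : Z 0 = W 0 := by simp [hZ, hQ0]
  -- (7) conclude
  intro t ht
  have hZt := hZle t ht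
  rw [hZ0] at hZt
  have hWt : W t = Z t * Real.exp (a * Q t) := by
    simp only [hZ]
    rw [mul_assoc, ← Real.exp_add]
    simp
  show W t ≤ (W 0 + b * s) * Real.exp (a * K)
  rw [hWt]
  have h1 : Z t ≤ W 0 + b * s := hZt.trans (by nlinarith [ht.2])
  have h2 : Real.exp (a * Q t) ≤ Real.exp (a * K) :=
    Real.exp_le_exp.2 (mul_le_mul_of_nonneg_left (hQle t ht) ha0)
  have h3 : 0 ≤ Z t := by simp only [hZ]; exact mul_nonneg (hWnn t) (Real.exp_pos _).le
  have h4 : 0 ≤ W 0 + b * s := by have := hWnn 0; positivity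
  exact mul_le_mul h1 h2 (Real.exp_pos _).le h4

end Apriori


/-! ## Global solutions of the Galerkin system -/

/-- **Global existence for the Galerkin truncation** (proof of Thm. 4.1: "from the theory of
ordinary differential equations we know that there exists a unique solution `u^k(t)` to
(galerkin) on `[0,∞)`", the `k`-th equation lacking the term `u_k u_{k+1}`). For `λ > 1`, `ν ≥ 0`,
any force `g`, datum `u⁰` and level `N` there is `u : ℕ → ℝ → ℝ` with `u₀ ≡ 0`, `uₙ ≡ 0` for
`n > N`, `uₙ(0) = u⁰ₙ` for `1 ≤ n ≤ N`, and the modes `1, …, N` solving (3.1) (with `u_{N+1} = 0`,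
i.e. the truncated system) within every `[0, T]`. Proof: the system is a polynomial ODE in
`Fin N → ℝ`, hence `C¹` and Lipschitz on balls (`ContDiffOn.exists_lipschitzOnWith`); the energy
bound `energy_le` is an a priori bound in the sup norm, and the continuation principle
`Literature.Analysis.ODE.exists_solution_of_apriori_bound` applies. [cite: Cheskidov2008, §4 Thm. 4.1 (proof)] [cite: Teschl2012, Cor. 2.16] -/
theorem exists_galerkin_solution {lam ν α : ℝ} (hlam : 1 < lam) (hν : 0 ≤ ν) (g : ℕ → ℝ)
    (u0 : ℕ → ℝ) (N : ℕ) :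
    ∃ u : ℕ → ℝ → ℝ, (∀ t, u 0 t = 0) ∧ (∀ n, N < n → ∀ t, u n t = 0) ∧
      (∀ n, 1 ≤ n → n ≤ N → u n 0 = u0 n) ∧
      ∀ T : ℝ, ∀ m < N, ∀ t ∈ Icc 0 T, HasDerivWithinAt (u (m + 1))
        (cheskidovRHS lam ν α g (fun k => u k t) (m + 1)) (Icc 0 T) t := by
  -- phase space and the dictionary with sequences
  let toSeq : (Fin N → ℝ) → ℕ → ℝ := fun c m =>
    if h : 1 ≤ m ∧ m ≤ N then c ⟨m - 1, by omega⟩ else 0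
  have htoSeq_succ : ∀ (c : Fin N → ℝ) (m : ℕ) (hm : m < N), toSeq c (m + 1) = c ⟨m, hm⟩ := by
    intro c m hm
    simp only [toSeq, dif_pos (show 1 ≤ m + 1 ∧ m + 1 ≤ N from ⟨by omega, by omega⟩),
      Nat.add_sub_cancel]
  have htoSeq_zero : ∀ c : Fin N → ℝ, toSeq c 0 = 0 := fun c => by simp [toSeq]
  have htoSeq_gt : ∀ (c : Fin N → ℝ) (m : ℕ), N < m → toSeq c m = 0 := fun c m hm => by
    simp only [toSeq, dif_neg (show ¬(1 ≤ m ∧ m ≤ N) by omega)]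
  -- the vector field
  let V : ℝ → (Fin N → ℝ) → (Fin N → ℝ) := fun _ c i => cheskidovRHS lam ν α g (toSeq c) (i + 1)
  -- smoothness of the field
  have hcoord : ∀ m : ℕ, ContDiff ℝ 1 fun c : Fin N → ℝ => toSeq c m := by
    intro m
    by_cases hm : 1 ≤ m ∧ m ≤ N
    · have : (fun c : Fin N → ℝ => toSeq c m) = fun c => c ⟨m - 1, by omega⟩ := by
        funext c; simp only [toSeq, dif_pos hm]
      rw [this]
      exact contDiff_apply ℝ ℝ (⟨m - 1, by omega⟩ : Fin N)
    · have : (fun c : Fin N → ℝ => toSeq c m) = fun _ => 0 := by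
        funext c; simp only [toSeq, dif_neg hm]
      rw [this]
      exact contDiff_const
  have hV : ContDiff ℝ 1 (V 0) := by
    refine contDiff_pi.2 fun i => ?_
    show ContDiff ℝ 1 fun c : Fin N → ℝ => cheskidovRHS lam ν α g (toSeq c) (i + 1)
    simp only [cheskidovRHS]
    exact ((((contDiff_const.mul (hcoord _)).add (contDiff_const.mul ((hcoord _).pow 2))).sub
      ((contDiff_const.mul (hcoord _)).mul (hcoord _))).add contDiff_const)
  -- Lipschitz on balls
  have hlip : ∀ T ρ : ℝ, ∃ K : ℝ≥0, ∀ t ∈ Icc 0 T, LipschitzOnWith K (V t) (closedBall 0 ρ) := by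
    intro T ρ
    obtain ⟨K, hK⟩ := hV.contDiffOn.exists_lipschitzOnWith one_ne_zero (convex_closedBall 0 ρ)
      (isCompact_closedBall 0 ρ)
    exact ⟨K, fun t _ => hK⟩
  have hcont : ∀ x : Fin N → ℝ, ContinuousOn (fun t => V t x) (Ici 0) := fun x => continuousOn_const
  -- the datum
  let x₀ : Fin N → ℝ := fun i => u0 (i + 1)
  set E0 : ℝ := ∑ m ∈ Finset.range N, u0 (m + 1) ^ 2 with hE0
  set GN : ℝ := ∑ m ∈ Finset.range N, g (m + 1) ^ 2 with hGN
  have hE0nn : 0 ≤ E0 := Finset.sum_nonneg fun m _ => sq_nonneg _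
  have hGNnn : 0 ≤ GN := Finset.sum_nonneg fun m _ => sq_nonneg _
  -- from a solution in the phase space to a Galerkin solution in sequences
  have dict : ∀ (S : Set ℝ) (β : ℝ → Fin N → ℝ),
      (∀ t ∈ S, HasDerivWithinAt β (V t (β t)) S t) →
      ∀ m < N, ∀ t ∈ S, HasDerivWithinAt (fun τ => toSeq (β τ) (m + 1))
        (cheskidovRHS lam ν α g (fun k => toSeq (β t) k) (m + 1)) S t := by
    intro S β hβ m hm t ht
    have h := hasDerivWithinAt_pi.1 (hβ t ht) ⟨m, hm⟩
    have heq : (fun τ => toSeq (β τ) (m + 1)) = fun τ => β τ ⟨m, hm⟩ := by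
      funext τ; exact htoSeq_succ (β τ) m hm
    rw [heq]
    exact h
  -- a priori bound
  have hapriori : ∀ T : ℝ, 0 ≤ T → ∃ R : ℝ, ‖x₀‖ ≤ R ∧ ∀ s ∈ Icc 0 T, ∀ β : ℝ → Fin N → ℝ,
      β 0 = x₀ → (∀ t ∈ Icc 0 s, HasDerivWithinAt β (V t (β t)) (Icc 0 s) t) →
      ∀ t ∈ Icc 0 s, ‖β t‖ ≤ R := by
    intro T hT
    set R : ℝ := Real.sqrt ((E0 + GN) * Real.exp T) with hR
    have hR0 : 0 ≤ R := Real.sqrt_nonneg _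
    have hexp1 : 1 ≤ Real.exp T := Real.one_le_exp hT
    refine ⟨R, ?_, ?_⟩
    · rw [pi_norm_le_iff_of_nonneg hR0]
      intro i
      rw [Real.norm_eq_abs, hR]
      refine Real.abs_le_sqrt ?_
      have h1 : u0 (i + 1) ^ 2 ≤ E0 := by
        rw [hE0]
        exact Finset.single_le_sum (f := fun m => u0 (m + 1) ^ 2) (fun m _ => sq_nonneg _)
          (Finset.mem_range.2 i.2)
      show u0 (i + 1) ^ 2 ≤ (E0 + GN) * Real.exp T
      nlinarith
    · intro s hs β hβ0 hβ t ht
      -- the associated sequence solution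
      have h0' : ∀ τ, toSeq (β τ) 0 = 0 := fun τ => htoSeq_zero _
      have hN' : ∀ τ, toSeq (β τ) (N + 1) = 0 := fun τ => htoSeq_gt _ _ (Nat.lt_succ_self N)
      have hd' := dict (Icc 0 s) β hβ
      have hen := energy_le (u := fun k τ => toSeq (β τ) k) h0' hN' hd' hν hlam le_rfl t ht
      have hinit : ∑ m ∈ Finset.range N, toSeq (β 0) (m + 1) ^ 2 = E0 := by
        rw [hE0]
        refine Finset.sum_congr rfl fun m hm => ?_
        rw [htoSeq_succ _ _ (Finset.mem_range.1 hm), hβ0]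
      rw [hinit] at hen
      rw [pi_norm_le_iff_of_nonneg hR0]
      intro i
      rw [Real.norm_eq_abs, hR]
      refine Real.abs_le_sqrt ?_
      have h1 : β t i ^ 2 ≤ ∑ m ∈ Finset.range N, toSeq (β t) (m + 1) ^ 2 := by
        have := Finset.single_le_sum (f := fun m => toSeq (β t) (m + 1) ^ 2)
          (fun m _ => sq_nonneg _) (Finset.mem_range.2 i.2)
        rwa [htoSeq_succ _ _ i.2] at this
      refine h1.trans (hen.trans ?_)
      have hexp2 : Real.exp s ≤ Real.exp T := Real.exp_le_exp.2 hs.2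
      nlinarith
  obtain ⟨β, hβ0, hβ⟩ := Literature.Analysis.ODE.exists_solution_of_apriori_bound hlip hcont hapriori
  refine ⟨fun m t => toSeq (β t) m, fun t => htoSeq_zero _, fun n hn t => htoSeq_gt _ _ hn, ?_, ?_⟩
  · intro n hn1 hnN
    obtain ⟨m, rfl⟩ : ∃ m, n = m + 1 := ⟨n - 1, by omega⟩
    show toSeq (β 0) (m + 1) = u0 (m + 1)
    rw [htoSeq_succ _ _ (by omega), hβ0]
  · intro T m hm t ht
    exact dict (Icc 0 T) β (hβ T) m hm t ht


/-! ## Compactness -/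

/-- **Diagonal extraction** (proof of Thm. 4.1: the approximations are equicontinuous, "the
Ascoli–Arzelà theorem implies that `{u^k}` is relatively compact in `C([0,T]; H_w)` … By a
diagonalization process … passing to a subsequence" every mode converges at every time). For a
family `U N n t` bounded by `R t` at each time `t ≥ 0` uniformly in `N, n`, and equi-Lipschitz in
`t` on every `[0, T]` for each mode `n`, there is a subsequence `φ` along which `U (φ j) n t`
converges for every `n` and every `t ≥ 0`. Proof: Tychonoff (`isCompact_univ_pi`) and
`IsCompact.tendsto_subseq` in the first-countable space `ℚ × ℕ → ℝ` give convergence at rational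
times; the Lipschitz modulus makes the subsequence Cauchy at every real time. [cite: Cheskidov2008, §4 Thm. 4.1 (proof)] -/
theorem exists_subseq_tendsto {U : ℕ → ℕ → ℝ → ℝ} {R : ℝ → ℝ}
    (hb : ∀ t, 0 ≤ t → ∀ N n, |U N n t| ≤ R t)
    (hl : ∀ T, 0 ≤ T → ∀ n, ∃ L, ∀ N, ∀ s ∈ Icc 0 T, ∀ t ∈ Icc 0 T,
      |U N n t - U N n s| ≤ L * |t - s|) :
    ∃ φ : ℕ → ℕ, StrictMono φ ∧ ∀ n, ∀ t, 0 ≤ t →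
      Tendsto (fun j => U (φ j) n t) atTop (𝓝 (limUnder atTop fun j => U (φ j) n t)) := by
  -- the sequence in the product space over the countable index set `ℚ × ℕ`
  let x : ℕ → (ℚ × ℕ → ℝ) := fun N p => U N p.2 (max (p.1 : ℝ) 0)
  let s : Set (ℚ × ℕ → ℝ) := Set.pi univ fun p => closedBall 0 (R (max (p.1 : ℝ) 0))
  have hs : IsCompact s := isCompact_univ_pi fun p => isCompact_closedBall _ _
  have hx : ∀ N, x N ∈ s := fun N => mem_univ_pi.2 fun p => by
    rw [mem_closedBall, dist_zero_right, Real.norm_eq_abs]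
    exact hb _ (le_max_right _ _) N p.2
  obtain ⟨a, -, φ, hφ, hlim⟩ := hs.tendsto_subseq hx
  rw [tendsto_pi_nhds] at hlim
  -- convergence at rational times `q ≥ 0`
  have hrat : ∀ q : ℚ, (0 : ℝ) ≤ q → ∀ n, Tendsto (fun j => U (φ j) n q) atTop (𝓝 (a (q, n))) := by
    intro q hq n
    have h := hlim (q, n)
    have heq : (fun j => (x ∘ φ) j (q, n)) = fun j => U (φ j) n q := by
      funext j
      simp only [Function.comp_apply, x, max_eq_left hq]
    rw [← heq]
    exact h
  -- the subsequence is Cauchy at every real time `t ≥ 0`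
  have hcauchy : ∀ n t, 0 ≤ t → CauchySeq fun j => U (φ j) n t := by
    intro n t ht
    rw [Metric.cauchySeq_iff]
    intro ε hε
    obtain ⟨L, hL⟩ := hl (t + 1) (by linarith) n
    set L' : ℝ := max L 0 + 1 with hL'
    have hL'pos : 0 < L' := by rw [hL']; positivity
    have hLL' : L ≤ L' := by rw [hL']; linarith [le_max_left L 0]
    set δ : ℝ := min 1 (ε / (3 * L')) with hδ
    have hδpos : 0 < δ := by rw [hδ]; positivity
    obtain ⟨q, hq1, hq2⟩ := exists_rat_btwn (show t < t + δ by linarith)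
    have hq0 : (0 : ℝ) ≤ q := ht.trans hq1.le
    have hqT : (q : ℝ) ≤ t + 1 := by linarith [min_le_left 1 (ε / (3 * L'))]
    have hqt : (q : ℝ) - t < ε / (3 * L') := by linarith [min_le_right 1 (ε / (3 * L'))]
    have hmod : ∀ N, |U N n t - U N n q| < ε / 3 := by
      intro N
      have h1 := hL N q ⟨hq0, hqT⟩ t ⟨ht, by linarith⟩
      have h2 : |t - (q : ℝ)| = q - t := by rw [abs_sub_comm]; exact abs_of_pos (by linarith)
      rw [h2] at h1
      calc |U N n t - U N n q| ≤ L * (q - t) := h1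
        _ ≤ L' * (q - t) := mul_le_mul_of_nonneg_right hLL' (by linarith)
        _ < L' * (ε / (3 * L')) := mul_lt_mul_of_pos_left hqt hL'pos
        _ = ε / 3 := by field_simp
    have hcq := (hrat q hq0 n).cauchySeq
    rw [Metric.cauchySeq_iff] at hcq
    obtain ⟨N₁, hN₁⟩ := hcq (ε / 3) (by positivity)
    refine ⟨N₁, fun j hj k hk => ?_⟩
    have e1 := hmod (φ j)
    have e2 := hN₁ j hj k hk
    have e3 := hmod (φ k)
    rw [Real.dist_eq] at e2 ⊢
    rw [abs_sub_comm] at e3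
    calc |U (φ j) n t - U (φ k) n t|
        = |(U (φ j) n t - U (φ j) n q) + (U (φ j) n q - U (φ k) n q) +
            (U (φ k) n q - U (φ k) n t)| := by ring_nf
      _ ≤ |U (φ j) n t - U (φ j) n q| + |U (φ j) n q - U (φ k) n q| +
            |U (φ k) n q - U (φ k) n t| := abs_add_three _ _ _
      _ < ε / 3 + ε / 3 + ε / 3 := add_lt_add (add_lt_add e1 e2) e3
      _ = ε := by ring
  exact ⟨φ, hφ, fun n t ht =>
    tendsto_nhds_limUnder (cauchySeq_tendsto_of_complete (hcauchy n t ht))⟩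


/-! ## The weighted norms -/

/-- The weighted norm `‖u‖²_γ = ∑_{n ≥ 1} λ^{2γn}uₙ²` as a sum over `n = m + 1`, `m ∈ ℕ`. [cite: Cheskidov2008, §3] -/
theorem dyadicNormSq_eq_tsum_succ (lam γ : ℝ) (u : ℕ → ℝ) :
    dyadicNormSq lam γ u =
      ∑' m : ℕ, ENNReal.ofReal (lam ^ (2 * γ * (m + 1 : ℕ)) * u (m + 1) ^ 2) := by
  unfold dyadicNormSq
  rw [tsum_eq_zero_add' ENNReal.summable]
  simp

/-- Partial sums of a finite weighted norm are bounded by its real value (`λ ≥ 0`). [folklore] -/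
theorem sum_range_le_toReal_dyadicNormSq {lam γ : ℝ} (hlam : 0 ≤ lam) {u : ℕ → ℝ}
    (h : dyadicNormSq lam γ u ≠ ⊤) (M : ℕ) :
    ∑ m ∈ Finset.range M, lam ^ (2 * γ * (m + 1 : ℕ)) * u (m + 1) ^ 2 ≤
      (dyadicNormSq lam γ u).toReal := by
  have hnn : ∀ m : ℕ, 0 ≤ lam ^ (2 * γ * (m + 1 : ℕ)) * u (m + 1) ^ 2 := fun m =>
    mul_nonneg (Real.rpow_nonneg hlam _) (sq_nonneg _)
  rw [← ENNReal.ofReal_le_iff_le_toReal h, ENNReal.ofReal_sum_of_nonneg (fun m _ => hnn m),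
    dyadicNormSq_eq_tsum_succ]
  exact ENNReal.sum_le_tsum (Finset.range M)

/-- A uniform bound on the partial sums bounds the weighted norm (`λ ≥ 0`). [folklore] -/
theorem dyadicNormSq_le_ofReal {lam γ : ℝ} (hlam : 0 ≤ lam) {u : ℕ → ℝ} {C : ℝ}
    (hC : ∀ M, ∑ m ∈ Finset.range M, lam ^ (2 * γ * (m + 1 : ℕ)) * u (m + 1) ^ 2 ≤ C) :
    dyadicNormSq lam γ u ≤ ENNReal.ofReal C := by
  have hnn : ∀ m : ℕ, 0 ≤ lam ^ (2 * γ * (m + 1 : ℕ)) * u (m + 1) ^ 2 := fun m =>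
    mul_nonneg (Real.rpow_nonneg hlam _) (sq_nonneg _)
  have hs : Summable fun m : ℕ => lam ^ (2 * γ * (m + 1 : ℕ)) * u (m + 1) ^ 2 :=
    summable_of_sum_range_le hnn hC
  rw [dyadicNormSq_eq_tsum_succ, ← ENNReal.ofReal_tsum_of_nonneg hnn hs]
  exact ENNReal.ofReal_le_ofReal (Real.tsum_le_of_sum_range_le hnn hC)

/-! ## Elementary properties of the right-hand side -/

/-- **Bound on the time derivatives** (proof of Thm. 4.1: `|u^k_n(t) - u^k_n(s)| ≤
(νλ^{2αn}M + λⁿM² + λ^{n+1}M² + gₙ)|t - s|`): if `|u_k| ≤ R` for all `k`, `ν ≥ 0`, `λ ≥ 0`, then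
`|RHS_{m+1}(u)| ≤ νλ^{2α(m+1)}R + λ^{m+1}R² + λ^{m+2}R² + |g_{m+1}|`. [cite: Cheskidov2008, §4 Thm. 4.1 (proof)] -/
theorem abs_cheskidovRHS_succ_le {lam ν α : ℝ} (hν : 0 ≤ ν) (hlam : 0 ≤ lam) (g : ℕ → ℝ)
    {u : ℕ → ℝ} {R : ℝ} (hR : 0 ≤ R) (hu : ∀ k, |u k| ≤ R) (m : ℕ) :
    |cheskidovRHS lam ν α g u (m + 1)| ≤
      ν * lam ^ (2 * α * (m + 1 : ℕ)) * R + lam ^ (m + 1) * R ^ 2 + lam ^ (m + 2) * R ^ 2 +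
        |g (m + 1)| := by
  rw [cheskidovRHS_succ]
  have hw : 0 ≤ lam ^ (2 * α * (m + 1 : ℕ)) := Real.rpow_nonneg hlam _
  have h1 : |(-ν) * lam ^ (2 * α * (m + 1 : ℕ)) * u (m + 1)| ≤
      ν * lam ^ (2 * α * (m + 1 : ℕ)) * R := by
    rw [abs_mul, abs_mul, abs_neg, abs_of_nonneg hν, abs_of_nonneg hw]
    exact mul_le_mul_of_nonneg_left (hu _) (mul_nonneg hν hw)
  have h2 : |lam ^ (m + 1) * u m ^ 2| ≤ lam ^ (m + 1) * R ^ 2 := by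
    rw [abs_mul, abs_of_nonneg (pow_nonneg hlam _), abs_of_nonneg (sq_nonneg _)]
    refine mul_le_mul_of_nonneg_left ?_ (pow_nonneg hlam _)
    have := hu m
    rw [← sq_abs]
    exact pow_le_pow_left₀ (abs_nonneg _) this 2
  have h3 : |lam ^ (m + 2) * u (m + 1) * u (m + 2)| ≤ lam ^ (m + 2) * R ^ 2 := by
    rw [abs_mul, abs_mul, abs_of_nonneg (pow_nonneg hlam _), mul_assoc, sq]
    refine mul_le_mul_of_nonneg_left ?_ (pow_nonneg hlam _)
    exact mul_le_mul (hu _) (hu _) (abs_nonneg _) hR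
  calc |(-ν) * lam ^ (2 * α * (m + 1 : ℕ)) * u (m + 1) + lam ^ (m + 1) * u m ^ 2 -
          lam ^ (m + 2) * u (m + 1) * u (m + 2) + g (m + 1)|
      ≤ |(-ν) * lam ^ (2 * α * (m + 1 : ℕ)) * u (m + 1) + lam ^ (m + 1) * u m ^ 2 -
          lam ^ (m + 2) * u (m + 1) * u (m + 2)| + |g (m + 1)| := abs_add_le _ _
    _ ≤ |(-ν) * lam ^ (2 * α * (m + 1 : ℕ)) * u (m + 1) + lam ^ (m + 1) * u m ^ 2| +
          |lam ^ (m + 2) * u (m + 1) * u (m + 2)| + |g (m + 1)| := by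
        gcongr
        exact abs_sub _ _
    _ ≤ |(-ν) * lam ^ (2 * α * (m + 1 : ℕ)) * u (m + 1)| + |lam ^ (m + 1) * u m ^ 2| +
          |lam ^ (m + 2) * u (m + 1) * u (m + 2)| + |g (m + 1)| := by
        gcongr
        exact abs_add_le _ _
    _ ≤ _ := by linarith

/-- The right-hand side at a fixed mode is continuous on a set along modes continuous there
(it involves the three modes `m, m+1, m+2` polynomially). [folklore] -/
theorem continuousOn_cheskidovRHS_succ {lam ν α : ℝ} {g : ℕ → ℝ} {U : ℕ → ℝ → ℝ} {S : Set ℝ}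
    (h : ∀ k, ContinuousOn (U k) S) (m : ℕ) :
    ContinuousOn (fun τ => cheskidovRHS lam ν α g (fun k => U k τ) (m + 1)) S := by
  simp only [cheskidovRHS_succ]
  exact (((continuousOn_const.mul (h _)).add (continuousOn_const.mul ((h _).pow 2))).sub
    ((continuousOn_const.mul (h _)).mul (h _))).add continuousOn_const

/-- The right-hand side at a fixed mode is continuous along continuous modes. [folklore] -/
theorem continuous_cheskidovRHS_succ {lam ν α : ℝ} {g : ℕ → ℝ} {U : ℕ → ℝ → ℝ}
    (h : ∀ k, Continuous (U k)) (m : ℕ) :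
    Continuous (fun τ => cheskidovRHS lam ν α g (fun k => U k τ) (m + 1)) := by
  simp only [cheskidovRHS_succ]
  exact (((continuous_const.mul (h _)).add (continuous_const.mul ((h _).pow 2))).sub
    ((continuous_const.mul (h _)).mul (h _))).add continuous_const

/-- The right-hand side at a fixed mode converges under modewise convergence of the states. [folklore] -/
theorem tendsto_cheskidovRHS_succ {lam ν α : ℝ} {g : ℕ → ℝ} {ι : Type*} {l : Filter ι}
    {F : ι → ℕ → ℝ} {v : ℕ → ℝ} (h : ∀ k, Tendsto (fun j => F j k) l (𝓝 (v k))) (m : ℕ) :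
    Tendsto (fun j => cheskidovRHS lam ν α g (F j) (m + 1)) l
      (𝓝 (cheskidovRHS lam ν α g v (m + 1))) := by
  simp only [cheskidovRHS_succ]
  exact (((tendsto_const_nhds.mul (h _)).add (tendsto_const_nhds.mul ((h _).pow 2))).sub
    ((tendsto_const_nhds.mul (h _)).mul (h _))).add tendsto_const_nhds

/-! ## Proof of Theorem 4.4 -/

/-- **Global strong solutions for `α ≥ 1/2`, for a force of any sign** (Cheskidov 2008, Thm. 4.4
and its proof, §4; the standing hypothesis `gₙ ≥ 0` of §3, made "for simplicity", is used in the
paper only for positivity (Thm. 4.2) and blow-up (§5), not in the energy/enstrophy argument).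
For `λ > 1`, `ν > 0`, `α ≥ 1/2`, every time-independent force with `∑ₙ gₙ² < ∞` and every datum
`u⁰ ∈ V = H^α` (any signs) there is a solution of (3.1) on `[0, ∞)` in the sense of Def. 3.1
(`IsCheskidovSolution`) whose enstrophy norm `‖u(t)‖²_α` is bounded on every `[0, T]`.
Proof (§4): Galerkin truncations (`exists_galerkin_solution`) obey, uniformly in the level, the
energy bound `energy_le`, the enstrophy bound `enstrophy_le` (`α ≥ 1/2`) and a modewise Lipschitz
bound (`abs_cheskidovRHS_succ_le`); a diagonal subsequence converges at every time
(`exists_subseq_tendsto`); the integral form of the truncated equations passes to the limit by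
dominated convergence, the limit modes are continuous, so by the fundamental theorem of calculus
they are `C¹` on `[0, ∞)` and solve (3.1); the enstrophy bound passes to the limit on partial sums,
giving `‖u(t)‖²_α ≤ C(T) < ∞` on `[0, T]` and in particular `u(t) ∈ ℓ²`. Audit 2026-08-16: this
sign-free form is the one in which the entry blocks forced variants at critical or subcritical
dissipation; the matching Leray–Hopf uniqueness for `β = 1/α ≤ 2` with forcing
`∑ λ^{-2n}∫fₙ² < ∞` is Filonov–Khodunov's Thm. 0.5 (not formalised here).
[cite: Cheskidov2008, §4 Thm. 4.4, Thm. 4.1 (proof); §3 p. 6 (standing hypotheses)] [cite: FilonovKhodunov2021, Thm. 0.5 and Thm. 0.9] -/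
theorem exists_strong_solution_of_half_le {lam ν α : ℝ} (hlam : 1 < lam) (hν : 0 < ν)
    (hα : 1 / 2 ≤ α) (g : ℕ → ℝ) (hgs : Summable fun n => g (n + 1) ^ 2) (u0 : ℕ → ℝ)
    (hu0 : dyadicNormSq lam α u0 < ⊤) :
    ∃ u : ℕ → ℝ → ℝ, IsCheskidovSolution lam ν α g u0 u ∧
      ∀ T : ℝ, 0 ≤ T → ∃ C : ENNReal, C < ⊤ ∧
        ∀ t ∈ Icc 0 T, dyadicNormSq lam α (fun n => u n t) ≤ C := by
  have hlam0 : (0 : ℝ) ≤ lam := by linarith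
  have hα0 : (0 : ℝ) ≤ α := by linarith
  have hw1 : ∀ m : ℕ, 1 ≤ lam ^ (2 * α * m) := fun m => one_le_wt hlam hα0 m
  -- the force
  set G : ℝ := ∑' m, g (m + 1) ^ 2 with hG
  have hGN : ∀ N, ∑ m ∈ Finset.range N, g (m + 1) ^ 2 ≤ G := fun N =>
    hgs.sum_le_tsum (Finset.range N) (fun m _ => sq_nonneg _)
  have hG0 : 0 ≤ G := tsum_nonneg fun m => sq_nonneg _
  -- the datum
  set S0 : ℝ := (dyadicNormSq lam α u0).toReal with hS0
  have hS0W : ∀ M, ∑ m ∈ Finset.range M, lam ^ (2 * α * (m + 1 : ℕ)) * u0 (m + 1) ^ 2 ≤ S0 :=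
    sum_range_le_toReal_dyadicNormSq hlam0 hu0.ne
  have hS0E : ∀ M, ∑ m ∈ Finset.range M, u0 (m + 1) ^ 2 ≤ S0 := fun M =>
    le_trans (Finset.sum_le_sum fun m _ => le_mul_of_one_le_left (sq_nonneg _) (hw1 (m + 1)))
      (hS0W M)
  have hS0nn : 0 ≤ S0 := ENNReal.toReal_nonneg
  -- Step 1: the Galerkin approximations
  choose U hU0 hUgt hUinit hUd using fun N => exists_galerkin_solution (α := α) hlam hν.le g u0 N
  have hUN1 : ∀ N t, U N (N + 1) t = 0 := fun N t => hUgt N (N + 1) (Nat.lt_succ_self N) t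
  -- Step 2a: the energy bound
  set R2 : ℝ → ℝ := fun T => (S0 + G) * Real.exp T with hR2
  have hR2nn : ∀ T, 0 ≤ R2 T := fun T => by simp only [hR2]; positivity
  have hEN : ∀ N T, ∀ t ∈ Icc 0 T, ∑ m ∈ Finset.range N, U N (m + 1) t ^ 2 ≤ R2 T := by
    intro N T t ht
    have h := energy_le (hU0 N) (hUN1 N) (hUd N T) hν.le hlam (hGN N) t ht
    refine h.trans ?_
    have hinit : ∑ m ∈ Finset.range N, U N (m + 1) 0 ^ 2 ≤ S0 := by
      calc ∑ m ∈ Finset.range N, U N (m + 1) 0 ^ 2 = ∑ m ∈ Finset.range N, u0 (m + 1) ^ 2 :=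
            Finset.sum_congr rfl fun m hm => by
              rw [hUinit N (m + 1) (by omega) (by have := Finset.mem_range.1 hm; omega)]
        _ ≤ S0 := hS0E N
    have := Real.exp_pos T
    simp only [hR2]
    nlinarith
  set R : ℝ → ℝ := fun T => Real.sqrt (R2 T) with hR
  have hR0 : ∀ T, 0 ≤ R T := fun T => Real.sqrt_nonneg _
  have hUabs : ∀ T, ∀ t ∈ Icc 0 T, ∀ N n, |U N n t| ≤ R T := by
    intro T t ht N n
    rcases Nat.eq_zero_or_pos n with rfl | hn
    · rw [hU0]; simpa using hR0 T
    obtain ⟨m, rfl⟩ : ∃ m, n = m + 1 := ⟨n - 1, by omega⟩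
    by_cases hm : m < N
    · refine Real.abs_le_sqrt ?_
      exact le_trans (Finset.single_le_sum (f := fun m => U N (m + 1) t ^ 2)
        (fun _ _ => sq_nonneg _) (Finset.mem_range.2 hm)) (hEN N T t ht)
    · rw [hUgt N (m + 1) (by omega)]; simpa using hR0 T
  -- Step 2b: the enstrophy bound
  set CW : ℝ → ℝ := fun T => (S0 + 3 / (2 * ν) * G * T) *
    Real.exp (3 * (lam ^ (4 * α) + 1) / (2 * ν) * ((R2 T + (G + R2 T) * T) / (2 * ν))) with hCW
  have hWN : ∀ N T, 0 ≤ T → ∀ t ∈ Icc 0 T,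
      ∑ m ∈ Finset.range N, lam ^ (2 * α * (m + 1 : ℕ)) * U N (m + 1) t ^ 2 ≤ CW T := by
    intro N T hT t ht
    have h := enstrophy_le (hU0 N) (hUN1 N) (hUd N T) hlam hν hα hT (hGN N)
      (fun τ hτ => hEN N T τ hτ) t ht
    refine h.trans ?_
    have hinit : ∑ m ∈ Finset.range N, lam ^ (2 * α * (m + 1 : ℕ)) * U N (m + 1) 0 ^ 2 ≤ S0 := by
      calc ∑ m ∈ Finset.range N, lam ^ (2 * α * (m + 1 : ℕ)) * U N (m + 1) 0 ^ 2
          = ∑ m ∈ Finset.range N, lam ^ (2 * α * (m + 1 : ℕ)) * u0 (m + 1) ^ 2 :=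
            Finset.sum_congr rfl fun m hm => by
              rw [hUinit N (m + 1) (by omega) (by have := Finset.mem_range.1 hm; omega)]
        _ ≤ S0 := hS0W N
    simp only [hCW]
    exact mul_le_mul_of_nonneg_right (by linarith) (Real.exp_pos _).le
  -- Step 2c: bounds on the time derivatives, equi-Lipschitz estimates
  set L : ℕ → ℝ → ℝ := fun m T => ν * lam ^ (2 * α * (m + 1 : ℕ)) * R T + lam ^ (m + 1) * R T ^ 2 +
    lam ^ (m + 2) * R T ^ 2 + |g (m + 1)| with hL
  have hderiv_bd : ∀ N T, ∀ t ∈ Icc 0 T, ∀ m,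
      |cheskidovRHS lam ν α g (fun k => U N k t) (m + 1)| ≤ L m T := fun N T t ht m =>
    abs_cheskidovRHS_succ_le hν.le hlam0 g (hR0 T) (fun k => hUabs T t ht N k) m
  have hlipU : ∀ T, 0 ≤ T → ∀ n, ∃ L', ∀ N, ∀ s ∈ Icc 0 T, ∀ t ∈ Icc 0 T,
      |U N n t - U N n s| ≤ L' * |t - s| := by
    intro T hT n
    rcases Nat.eq_zero_or_pos n with rfl | hn
    · exact ⟨0, fun N s _ t _ => by simp [hU0]⟩
    obtain ⟨m, rfl⟩ : ∃ m, n = m + 1 := ⟨n - 1, by omega⟩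
    refine ⟨L m T, fun N s hs t ht => ?_⟩
    by_cases hm : m < N
    · have := Convex.norm_image_sub_le_of_norm_hasDerivWithin_le (C := L m T)
        (fun τ hτ => hUd N T m hm τ hτ)
        (fun τ hτ => by rw [Real.norm_eq_abs]; exact hderiv_bd N T τ hτ m) (convex_Icc 0 T) hs ht
      simpa [Real.norm_eq_abs] using this
    · simp only [hUgt N (m + 1) (by omega), sub_self, abs_zero]
      have := hR0 T
      positivity
  -- Step 3: extraction of a convergent subsequence
  obtain ⟨φ, hφ, hconv⟩ := exists_subseq_tendsto (R := R)
    (fun t ht N n => hUabs t t ⟨ht, le_rfl⟩ N n) hlipU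
  set v : ℕ → ℝ → ℝ := fun n t => limUnder atTop fun j => U (φ j) n t with hv
  replace hconv : ∀ n t, 0 ≤ t → Tendsto (fun j => U (φ j) n t) atTop (𝓝 (v n t)) := hconv
  -- Step 4: first properties of the limit
  have hv0 : ∀ t, v 0 t = 0 := by
    intro t
    have : (fun j => U (φ j) 0 t) = fun _ => 0 := funext fun j => hU0 _ _
    simp only [hv, this]
    exact tendsto_const_nhds.limUnder_eq
  have hvinit : ∀ n, 1 ≤ n → v n 0 = u0 n := by
    intro n hn
    refine tendsto_nhds_unique (hconv n 0 le_rfl) (tendsto_const_nhds.congr' ?_)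
    filter_upwards [hφ.tendsto_atTop.eventually (eventually_ge_atTop n)] with j hj
    exact (hUinit (φ j) n hn hj).symm
  have hvlip : ∀ T, 0 ≤ T → ∀ n, ∃ L', ∀ s ∈ Icc 0 T, ∀ t ∈ Icc 0 T,
      |v n t - v n s| ≤ L' * |t - s| := by
    intro T hT n
    obtain ⟨L', hL'⟩ := hlipU T hT n
    exact ⟨L', fun s hs t ht => le_of_tendsto (((hconv n t ht.1).sub (hconv n s hs.1)).abs)
      (Eventually.of_forall fun j => hL' (φ j) s hs t ht)⟩
  have hvcontT : ∀ T, 0 ≤ T → ∀ n, ContinuousOn (v n) (Icc 0 T) := by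
    intro T hT n
    obtain ⟨L', hL'⟩ := hvlip T hT n
    have : LipschitzOnWith (Real.toNNReal L') (v n) (Icc 0 T) :=
      LipschitzOnWith.of_dist_le_mul fun s hs t ht => by
        rw [Real.dist_eq, Real.dist_eq]
        exact (hL' t ht s hs).trans
          (mul_le_mul_of_nonneg_right (Real.le_coe_toNNReal L') (abs_nonneg _))
    exact this.continuousOn
  have hvcont : ∀ n, ContinuousOn (v n) (Ici 0) := by
    intro n t ht
    have ht' : (0 : ℝ) ≤ t := ht
    have hmem : Icc 0 (t + 1) ∈ 𝓝[Ici 0] t :=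
      Filter.mem_of_superset (inter_mem_nhdsWithin (Ici (0 : ℝ)) (Iio_mem_nhds (by linarith)))
        fun s hs => ⟨hs.1, hs.2.le⟩
    exact (hvcontT (t + 1) (by linarith) n t ⟨ht', by linarith⟩).mono_of_mem_nhdsWithin hmem
  have hvmax : ∀ n, Continuous fun τ => v n (max τ 0) := fun n =>
    (hvcont n).comp_continuous (f := fun τ : ℝ => max τ 0) (continuous_id.max continuous_const)
      fun τ => Set.mem_Ici.2 (le_max_right τ 0)
  -- Step 5: the Galerkin equations in integral form
  have hUcont : ∀ N n T, ContinuousOn (U N n) (Icc 0 T) := by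
    intro N n T
    rcases Nat.eq_zero_or_pos n with rfl | hn
    · have : U N 0 = fun _ => 0 := funext fun t => hU0 N t
      rw [this]; exact continuousOn_const
    obtain ⟨m, rfl⟩ : ∃ m, n = m + 1 := ⟨n - 1, by omega⟩
    by_cases hm : m < N
    · exact fun t ht => (hUd N T m hm t ht).continuousWithinAt
    · have : U N (m + 1) = fun _ => 0 := funext fun t => hUgt N (m + 1) (by omega) t
      rw [this]; exact continuousOn_const
  have hint : ∀ N, ∀ m < N, ∀ t, 0 ≤ t → U N (m + 1) t =
      u0 (m + 1) + ∫ τ in (0 : ℝ)..t, cheskidovRHS lam ν α g (fun k => U N k τ) (m + 1) := by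
    intro N m hm t ht
    have hcRHS : ContinuousOn (fun τ => cheskidovRHS lam ν α g (fun k => U N k τ) (m + 1))
        (Icc 0 t) :=
      continuousOn_cheskidovRHS_succ (fun k => hUcont N k t) m
    have h := intervalIntegral.integral_eq_sub_of_hasDeriv_right_of_le ht (hUcont N (m + 1) t)
      (fun τ hτ => ((hUd N t m hm τ (Ioo_subset_Icc_self hτ)).mono_of_mem_nhdsWithin ?_))
      (hcRHS.intervalIntegrable_of_Icc ht)
    · rw [h, hUinit N (m + 1) (by omega) (by omega)]
      ring
    · exact mem_nhdsWithin.2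
        ⟨Iio t, isOpen_Iio, hτ.2, fun z hz => ⟨hτ.1.le.trans (le_of_lt hz.2), hz.1.le⟩⟩
  -- Step 6: passage to the limit in the integral form
  have hint_v : ∀ m t, 0 ≤ t → v (m + 1) t =
      u0 (m + 1) + ∫ τ in (0 : ℝ)..t, cheskidovRHS lam ν α g (fun k => v k τ) (m + 1) := by
    intro m t ht
    have h1 : Tendsto (fun j => U (φ j) (m + 1) t) atTop (𝓝 (v (m + 1) t)) := hconv _ t ht
    have h2 : Tendsto (fun j => u0 (m + 1) +
        ∫ τ in (0 : ℝ)..t, cheskidovRHS lam ν α g (fun k => U (φ j) k τ) (m + 1)) atTop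
        (𝓝 (u0 (m + 1) + ∫ τ in (0 : ℝ)..t, cheskidovRHS lam ν α g (fun k => v k τ) (m + 1))) := by
      refine tendsto_const_nhds.add ?_
      refine intervalIntegral.tendsto_integral_filter_of_dominated_convergence (fun _ => L m t)
        ?_ ?_ ?_ ?_
      · refine Eventually.of_forall fun j => ?_
        have hc := continuousOn_cheskidovRHS_succ (lam := lam) (ν := ν) (α := α) (g := g) (m := m)
          (fun k => hUcont (φ j) k t)
        rw [uIoc_of_le ht]
        exact (hc.mono Ioc_subset_Icc_self).aestronglyMeasurable measurableSet_Ioc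
      · refine Eventually.of_forall fun j => ae_of_all _ fun τ hτ => ?_
        rw [uIoc_of_le ht] at hτ
        rw [Real.norm_eq_abs]
        exact hderiv_bd (φ j) t τ (Ioc_subset_Icc_self hτ) m
      · exact intervalIntegrable_const
      · refine ae_of_all _ fun τ hτ => ?_
        rw [uIoc_of_le ht] at hτ
        exact tendsto_cheskidovRHS_succ (fun k => hconv k τ hτ.1.le) m
    have h3 : ∀ᶠ j in atTop, U (φ j) (m + 1) t =
        u0 (m + 1) + ∫ τ in (0 : ℝ)..t, cheskidovRHS lam ν α g (fun k => U (φ j) k τ) (m + 1) := by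
      filter_upwards [hφ.tendsto_atTop.eventually (eventually_gt_atTop m)] with j hj
      exact hint (φ j) m hj t ht
    exact tendsto_nhds_unique (h1.congr' h3) h2
  -- Step 7: differentiate the integral form
  have hderiv_v : ∀ m t, 0 ≤ t → HasDerivWithinAt (v (m + 1))
      (cheskidovRHS lam ν α g (fun k => v k t) (m + 1)) (Ici 0) t := by
    intro m t ht
    set f : ℝ → ℝ := fun τ => cheskidovRHS lam ν α g (fun k => v k (max τ 0)) (m + 1) with hf
    have hfc : Continuous f := continuous_cheskidovRHS_succ hvmax m
    have hΦ : HasDerivAt (fun s => u0 (m + 1) + ∫ τ in (0 : ℝ)..s, f τ) (f t) t :=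
      (intervalIntegral.integral_hasDerivAt_right (hfc.intervalIntegrable 0 t)
        (hfc.stronglyMeasurableAtFilter _ _) hfc.continuousAt).const_add _
    have heq : ∀ s ∈ Ici (0 : ℝ), v (m + 1) s = u0 (m + 1) + ∫ τ in (0 : ℝ)..s, f τ := by
      intro s hs
      have hs' : (0 : ℝ) ≤ s := hs
      rw [hint_v m s hs']
      congr 1
      refine intervalIntegral.integral_congr fun τ hτ => ?_
      rw [uIcc_of_le hs'] at hτ
      simp only [hf, max_eq_left hτ.1]
    have hft : f t = cheskidovRHS lam ν α g (fun k => v k t) (m + 1) := by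
      simp only [hf, max_eq_left ht]
    rw [← hft]
    exact hΦ.hasDerivWithinAt.congr (fun s hs => heq s hs) (heq t ht)
  -- Step 8: the enstrophy bound passes to the limit
  have hWv : ∀ T, 0 ≤ T → ∀ t ∈ Icc 0 T, ∀ M,
      ∑ m ∈ Finset.range M, lam ^ (2 * α * (m + 1 : ℕ)) * v (m + 1) t ^ 2 ≤ CW T := by
    intro T hT t ht M
    have hlimsum : Tendsto (fun j => ∑ m ∈ Finset.range M,
        lam ^ (2 * α * (m + 1 : ℕ)) * U (φ j) (m + 1) t ^ 2) atTop
        (𝓝 (∑ m ∈ Finset.range M, lam ^ (2 * α * (m + 1 : ℕ)) * v (m + 1) t ^ 2)) :=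
      tendsto_finsetSum _ fun m _ => ((hconv (m + 1) t ht.1).pow 2).const_mul _
    refine le_of_tendsto hlimsum ?_
    filter_upwards [hφ.tendsto_atTop.eventually (eventually_ge_atTop M)] with j hj
    refine le_trans ?_ (hWN (φ j) T hT t ht)
    exact Finset.sum_le_sum_of_subset_of_nonneg (Finset.range_mono hj) fun m _ _ => by
      have := wt_pos hlam α (m + 1); positivity
  -- conclusion
  refine ⟨v, ⟨hv0, hvinit, ?_, ?_⟩, ?_⟩
  · intro n hn t ht
    obtain ⟨m, rfl⟩ : ∃ m, n = m + 1 := ⟨n - 1, by omega⟩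
    exact hderiv_v m t ht
  · intro t ht
    have hsum : Summable fun m => lam ^ (2 * α * (m + 1 : ℕ)) * v (m + 1) t ^ 2 :=
      summable_of_sum_range_le (fun m => by have := wt_pos hlam α (m + 1); positivity)
        (hWv t ht t ⟨ht, le_rfl⟩)
    have hsum' : Summable fun m => v (m + 1) t ^ 2 :=
      hsum.of_nonneg_of_le (fun m => sq_nonneg _) fun m =>
        le_mul_of_one_le_left (sq_nonneg _) (hw1 (m + 1))
    exact (summable_nat_add_iff 1).1 hsum'
  · intro T hT
    refine ⟨ENNReal.ofReal (CW T), ENNReal.ofReal_lt_top, fun t ht => ?_⟩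
    exact dyadicNormSq_le_ofReal hlam0 (hWv T hT t ht)

/-- **Cheskidov 2008, Theorem 4.4, proved** ("If `α ≥ 1/2`, then for any `u⁰ ∈ V` there exists
a strong solution `u(t)` to (3.1) on `[0,∞)` with `u(0) = u⁰`"; standing hypotheses `λ > 1`,
`ν > 0`, `g ∈ H` time-independent with `gₙ ≥ 0`). Discharges the named fact
`Dyadic.Cheskidov2008_thm44` of `DyadicCascadeRegularity`; it is the specialisation of
`exists_strong_solution_of_half_le`, the sign condition on the force being discarded.
[cite: Cheskidov2008, §4 Thm. 4.4, Thm. 4.1 (proof)] -/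
theorem Cheskidov2008_thm44_holds : Cheskidov2008_thm44 := by
  intro lam ν α hlam hν hα g _hg hgs u0 hu0
  exact exists_strong_solution_of_half_le hlam hν hα g hgs u0 hu0

end Literature.Barriers.NavierStokesRegularity.Dyadic
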